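import Literature.Geometry.Riemannian.ShrinkerPotentialGrowth
import Literature.Geometry.Riemannian.GradientShrinkerProofs
import Literature.Geometry.Riemannian.GradientEstimateIntegration
import Literature.Geometry.Lorentzian.HessianLocalMax
import Literature.Geometry.Riemannian.BonnetMyers
import Literature.Geometry.Riemannian.NonTrappingConvexSublevelProofs
import Literature.Geometry.Riemannian.HopfRinowHeineBorel
import Literature.Geometry.Riemannian.ParallelTransport
import Literature.Geometry.Riemannian.ExpMapIndexNonneg
import Literature.Geometry.Lorentzian.CoordEntropyFormula
import Literature.Geometry.Lorentzian.ConformalCoordCurvature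
import HarnessLib

/-!
# Growth of the potential of a gradient shrinker: Haslhofer–Müller 2011, Lemma 2.1, PROVED given
# (2.6) — the `½`-Lipschitz bound for `√f`, the value at a minimum, the second variation
# inequality along minimizing geodesics, (2.distancebound), the minimum point, both growth bounds

Sibling proof file of `ShrinkerPotentialGrowth.lean`, whose named fact
`shrinkerPotentialGrowth` renders R. Haslhofer, R. Müller, *A compactness theorem for complete
Ricci shrinkers*, GAFA 21 (2011) = arXiv:1005.3255, §2: (2.6) `R ≥ 0`, Lemma 2.1 (growth of the
potential) and Lemma 2.2 (volume growth), for complete connected gradient shrinkers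
`Ric + Hess f = g/2` normalised by `R + |∇f|² = f` (`C₁ = 0`). Everything in this file is PROVED;
no definition and no statement of `Prop` type is introduced (D-0026). Net effect: **Lemma 2.1 is
proved for every shrinker satisfying (2.6)**, and the fact is reduced to (2.6) and Lemma 2.2
(`shrinkerPotentialGrowth_of_nonneg_of_volume`).

## The printed proof of Lemma 2.1 (App., p. 15 of the arXiv text) and what is here

* "(2.dfbound) From (2.5) and (2.6), we obtain `0 ≤ |∇f|² ≤ f + C₁`, i.e.
  `|∇√(f + C₁)| ≤ ½` whenever `f + C₁ > 0`. Hence `√(f + C₁)` is `½`-Lipschitz and thus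
  (2.lipschitz) `√(f(x) + C₁) ≤ ½ (d(x,y) + 2√(f(y) + C₁))` for all `x, y ∈ M`, which will give
  the upper bound in (2.quadgrowth)." PROVED (`§ Lipschitz`, any model space, any `C¹` function
  with `|∇f|²_g ≤ f`): `abs_mvfderiv_sqrt_add_le` (`|d√(f+δ)(v)| ≤ ½|v|_g` for `δ > 0`, by the
  chain rule and the Cauchy–Schwarz inequality `|df(v)| ≤ |∇f|_g |v|_g`),
  `ofReal_two_mul_sqrt_sub_sqrt_le_edist` (`2(√f(y) − √f(x)) ≤ d(x, y)` as extended reals —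
  the tree's `ofReal_abs_sub_le_mul_riemEDist`, then `δ → 0`), and
  `le_quarter_sq_of_edist_le` (`d(p, x) ≤ r ⇒ f(x) ≤ ¼ (r + 2√f(p))²`).
* "The idea to prove the lower bound is the same as in the theorem of Myers … Consider a
  minimizing geodesic `γ(s)`, `0 ≤ s ≤ s₀ := d(x,y)` … Assume `s₀ > 2` and let `φ(s) = s` on
  `[0,1]`, `1` on `[1,s₀-1]`, `s₀-s` on `[s₀-1,s₀]`. By the second variation formula for the
  energy of `γ`, `∫₀^{s₀} φ² Rc(γ',γ') ds ≤ (n-1)∫₀^{s₀} φ'² ds = 2n - 2`." PROVED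
  (`§ MatrixLayer`, `§ Geodesic`) through the Jacobi-tensor (matrix Riccati) layer of the tree
  (`VolumeSphereTheoremProofs.lean`, §8; Chavel 2006, Thm. III.4.3) instead of variations of the
  energy: `jacobi_index_piece` (`∫φ²ρ ≤ m∫φ'² − [φ² tr 𝒰]` on a `C¹` piece, `𝒰 = 𝒜'𝒜⁻¹`),
  `jacobi_index_trapezoid` (`∫₀¹t²ρ + ∫₁^{L-1}ρ + ∫_{L-1}^L(L-t)²ρ ≤ 2m`), and
  `ricci_trapezoid_le_of_isMinimizingUpTo` — the inequality along the unit speed minimizing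
  segment `γ_u|[0,s₀]` on every `[0, L]`, `2 < L < s₀` (parallel orthonormal frame,
  `exists_fullFrame_along_maximalGeodesic`; no conjugate points before `s₀`, Lee 2018,
  Thm. 10.26; `normalJacobiTensor_frame_hyps` with `tr ℛ = Ric(γ̇, γ̇)`).
* "Note that by the soliton equation `Rc(γ',γ') = ½ - ∇_{γ'}∇_{γ'}f`, which implies
  (2.distancebound) `d(x,y)/2 + 4/3 - 2n ≤ … ≤ √(f(x)+C₁) + ½ + √(f(y)+C₁) + ½`." PROVED
  (`§ Geodesic`): `hm_distance_bound` (on `[0, L]`: `L/2 + 2/3 - 2n - √f(p) ≤ √f(γ_u(L))`, by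
  `F'' = Hess f(γ̇,γ̇)`, integration by parts, `|F'| ≤ |∇f| ≤ √f` and (2.lipschitz) along the
  segment; the printed constant improved by `1/3`), `hm_distance_bound_endpoint` (`L → s₀`),
  `hm_distance_bound_of_edist` (any two points with `d(y,x) > 2`, by Hopf–Rinow:
  `isGeodesicallyComplete_iff_isCompact_setOf_edist_le`,
  `exists_isMinimizingUpTo_of_isGeodesicallyComplete`, unit speed reparametrisation).
* "By (2.distancebound), every minimizing sequence is bounded and `f` attains its infimum at a
  point `p`." PROVED: `exists_forall_potential_le` (the sub-level set `{f ≤ f(y₀)}` lies in a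
  compact ball).
* "Since `Δf(p) ≥ 0`, (2.3) and (2.6) imply (2.Rpest) `0 ≤ R(p) ≤ n/2`. Using this and
  `∇f(p) = 0`, equation (2.5) implies (2.fcest) `0 ≤ f(p) + C₁ ≤ n/2`." PROVED (`§ Minimum`) at any
  local minimum `p` of the potential of a normalised shrinker, WITHOUT (2.6):
  `potential_eq_scalarCurvature_of_isLocalMin` (`f(p) = R(p)`: Fermat, `∇f(p) = 0`) and
  `potential_le_half_dim_of_isLocalMin` (`f(p) ≤ n/2`: the trace (2.3) `R + Δf = n/2`,
  `IsGradientShrinker.scalarCurvature_add_dalembertian`, and `Δf(p) = tr_g Hess f(p) ≥ 0`,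
  `dalembertian_nonneg_of_isLocalMin`).
* "Now the quadratic growth estimate (2.quadgrowth) follows from (2.lipschitz), (2.distancebound)
  and (2.fcest) by setting `y = p`." PROVED, given (2.6) for the shrinker at hand as a hypothesis:
  `potential_le_of_scalarCurvature_nonneg` (`§ Upper`, UPPER clause:
  `d(p, x) ≤ r ⇒ f(x) ≤ ¼ (r + √(2n))²`) and `potential_lower_of_scalarCurvature_nonneg`
  (`§ Geodesic`, LOWER clause: `r ≤ d(p, x) ⇒ ¼ (r - 5n)₊² ≤ f(x)`, using
  `√(n/2) ≤ n/2 + 2/3`) — literally conjunct (b) of `shrinkerPotentialGrowth`.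
* `shrinkerPotentialGrowth_of_nonneg_of_lower_of_volume` (`§ Assembly`) and
  `shrinkerPotentialGrowth_of_nonneg_of_volume` (`§ AssemblyTwo`) — REDUCTIONS, not discharges:
  the named fact follows from (A) (2.6) `R ≥ 0` on every complete connected normalised shrinker
  and (V) Lemma 2.2 about every minimum point, both entering as hypotheses over the data of the
  fact.

* Towards (2.6) `R ≥ 0` by the elliptic maximum principle ([Zha09]; B.-L. Chen): `§ CoordIdentities`
  — the printed identities (2.3) (traced), (2.4) `Ric(∇f, ·) = ½∇R`, (2.5) `d(R + |∇f|² − f) = 0`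
  and (2.7) `ΔR = ⟨∇f, ∇R⟩ + R − 2|Ric|²` (normalisation `R + |∇f|² = f`) for metric components
  in coordinates (`MetricCoord`: contracted Bianchi identity, divergence of the Hessian, Bochner
  formula); `§ ParallelSmooth` — parallel fields along `C^∞` curves have `C^∞` lifts (linear ODE
  bootstrap), so that cut-off parallel frames are admissible variation fields; `§ Barrier` — the
  distance barrier `d(p, exp_{γ(T)}(σX(T))) ≤ T + σ g(X(T), γ̇(T)) + σ²(∫₀ᵀ q + εT)/2` along a unit
  speed geodesic from `p` (two-sided energy Taylor bound `integral_energy_le_taylor`, `d ≤ L`,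
  Cauchy–Schwarz), the second-variation input of the weighted Laplacian comparison.

What is NOT here (the inputs (A), (V) of `shrinkerPotentialGrowth_holds`): (2.6) `R ≥ 0` itself
([Zha09]; B.-L. Chen's maximum principle on the complete non-compact `M` — equivalently, by an
elliptic route, the weighted Laplacian comparison `Δ_f d(p, ·) ≤ C − d/2` for `Ric_f = g/2` and a
localised maximum principle for `Δ_f R = R − 2|Ric|²`, (2.7)), and Lemma 2.2 (volume of sub-level
sets of `f`, Bakry–Émery volume comparison for small radii).

## References

* [HaslhoferMuller2011] R. Haslhofer, R. Müller, GAFA 21 (2011), 1091–1116 = arXiv:1005.3255: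
  §2 (2.2)–(2.7), Lemma 2.1 (p. 5); App., proof of Lemma 2.1 (p. 15). READ.
* [CaoZhou2009] H.-D. Cao, D. Zhou, *On complete gradient shrinking Ricci solitons*,
  J. Differential Geom. 85 (2010), 175–186, Prop. 2.1 (the original of Lemma 2.1).
* [Chavel2006] I. Chavel, *Riemannian geometry: a modern introduction*, 2nd ed., CUP 2006,
  §III.4, Thm. III.4.3 and its proof ((III.4.16)–(III.4.18): the matrix Riccati equation).
* [LeeRiemannianManifolds2018] J. M. Lee, *Introduction to Riemannian Manifolds*, 2nd ed. (2018),
  Thm. 10.26 (no conjugate points before the cut time), Cor. 6.21 (Hopf–Rinow).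
-/

noncomputable section

open Bundle Set Function Filter Manifold Module MeasureTheory
open scoped Manifold ContDiff Topology ENNReal NNReal

namespace Literature.Geometry.Riemannian

open Lorentzian Lorentzian.PseudoRiemannianMetric

namespace HaslhoferMuller

/-! ### (2.lipschitz): `√f` is `½`-Lipschitz when `|∇f|² ≤ f` -/

section Lipschitz

variable {E : Type*} [NormedAddCommGroup E] [NormedSpace ℝ E] [FiniteDimensional ℝ E]
  {H : Type*} [TopologicalSpace H] {I : ModelWithCorners ℝ E H}
  {M : Type*} [TopologicalSpace M] [ChartedSpace H M] [IsManifold I ∞ M]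
  (g : PseudoRiemannianMetric I ∞ E (TangentSpace I : M → Type _))

/-- An elementary square-root inequality: `√(a + δ) ≤ √a + √δ` for `a, δ ≥ 0`. [folklore] -/
theorem sqrt_add_le_sqrt_add_sqrt {a δ : ℝ} (ha : 0 ≤ a) (hδ : 0 ≤ δ) :
    Real.sqrt (a + δ) ≤ Real.sqrt a + Real.sqrt δ := by
  rw [Real.sqrt_le_left (add_nonneg (Real.sqrt_nonneg _) (Real.sqrt_nonneg _))]
  nlinarith [Real.sq_sqrt ha, Real.sq_sqrt hδ, Real.sqrt_nonneg a, Real.sqrt_nonneg δ]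

/-- **`|∇√(f + C₁)| ≤ ½` (Haslhofer–Müller 2011, App., proof of Lemma 2.1, from (2.dfbound)
`0 ≤ |∇f|² ≤ f + C₁`)**, here with `C₁ = 0` and a regularising `δ > 0`: if `f` is differentiable
at `x` with `|∇f|²_g(x) ≤ f(x)` for a Riemannian `g`, then
`|d(√(f + δ))_x(v)| ≤ ½ |v|_g` for every tangent vector `v` (chain rule
`d√(f+δ) = df / (2√(f+δ))` and Cauchy–Schwarz `|df(v)| ≤ |∇f|_g |v|_g ≤ √(f+δ) |v|_g`).
[cite: HaslhoferMuller2011, App., proof of Lemma 2.1 (p. 15)] -/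
theorem abs_mvfderiv_sqrt_add_le (hg : g.IsRiemannian) {f : M → ℝ} {x : M}
    (hfx : MDifferentiableAt I 𝓘(ℝ, ℝ) f x) (hgrad : g.gradSq f x ≤ f x) {δ : ℝ} (hδ : 0 < δ)
    (v : TangentSpace I x) :
    |mvfderiv I (fun z ↦ Real.sqrt (f z + δ)) x v| ≤ (1 / 2 : ℝ) * Real.sqrt (g.val x v v) := by
  have hf0 : 0 ≤ f x := (g.gradSq_nonneg hg f x).trans hgrad
  have hpos : 0 < f x + δ := by linarith
  have hsq : 0 < Real.sqrt (f x + δ) := Real.sqrt_pos.2 hpos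
  -- the chain rule `d√(f+δ) = df / (2√(f+δ))`
  have hderiv : HasDerivAt (fun t : ℝ ↦ Real.sqrt (t + δ)) (1 / (2 * Real.sqrt (f x + δ))) (f x) := by
    have h1 : HasDerivAt (fun t : ℝ ↦ t + δ) 1 (f x) := (hasDerivAt_id (f x)).add_const δ
    have h2 := h1.sqrt hpos.ne'
    simpa using h2
  have hcomp : mvfderiv I (fun z ↦ Real.sqrt (f z + δ)) x v =
      1 / (2 * Real.sqrt (f x + δ)) * mvfderiv I f x v := by
    have h := mvfderiv_real_comp_apply (φ := f) (h := fun t : ℝ ↦ Real.sqrt (t + δ)) hderiv hfx v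
    simpa [Function.comp_def] using h
  rw [hcomp, abs_mul, abs_of_pos (by positivity : (0 : ℝ) < 1 / (2 * Real.sqrt (f x + δ)))]
  -- Cauchy–Schwarz and `|∇f| ≤ √f ≤ √(f + δ)`
  have hcs := abs_mvfderiv_le_sqrt_gradSq_mul_sqrt g hg f x v
  have hgradf : Real.sqrt (g.gradSq f x) ≤ Real.sqrt (f x + δ) :=
    Real.sqrt_le_sqrt (by linarith)
  have hv0 : 0 ≤ Real.sqrt (g.val x v v) := Real.sqrt_nonneg _
  calc 1 / (2 * Real.sqrt (f x + δ)) * |mvfderiv I f x v|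
      ≤ 1 / (2 * Real.sqrt (f x + δ)) * (Real.sqrt (f x + δ) * Real.sqrt (g.val x v v)) := by
        refine mul_le_mul_of_nonneg_left (hcs.trans ?_) (by positivity)
        exact mul_le_mul_of_nonneg_right hgradf hv0
    _ = (1 / 2 : ℝ) * Real.sqrt (g.val x v v) := by
        field_simp

/-- **`√(f + C₁)` is `½`-Lipschitz (Haslhofer–Müller 2011, App., proof of Lemma 2.1,
(2.lipschitz): "`√(f(x) + C₁) ≤ ½ (d(x,y) + 2√(f(y) + C₁))` for all `x, y ∈ M`")**, here with
`C₁ = 0`: for a Riemannian `g` and a `C¹` function with `|∇f|²_g ≤ f` everywhere,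
`2 (√f(y) − √f(x)) ≤ d(x, y)` for all `x, y`, the Riemannian distance being the extended distance
`g.edist` (so the statement is vacuous when `d(x, y) = ∞`). Proof: `√(f + δ)` has differential
bounded by `½ |·|_g` (`abs_mvfderiv_sqrt_add_le`), hence is `½`-Lipschitz for `d`
(`ofReal_abs_sub_le_mul_riemEDist`), and `√f(y) − √f(x) ≤ √(f(y)+δ) − √(f(x)+δ) + √δ`, `δ → 0`.
[cite: HaslhoferMuller2011, App., proof of Lemma 2.1, (2.lipschitz) (p. 15)] -/
theorem ofReal_two_mul_sqrt_sub_sqrt_le_edist (hg : g.IsRiemannian) {f : M → ℝ}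
    (hf : ContMDiff I 𝓘(ℝ, ℝ) 1 f) (hgrad : ∀ x, g.gradSq f x ≤ f x) (x y : M) :
    ENNReal.ofReal (2 * (Real.sqrt (f y) - Real.sqrt (f x))) ≤ g.edist hg x y := by
  have hf0 : ∀ z, 0 ≤ f z := fun z ↦ (g.gradSq_nonneg hg f z).trans (hgrad z)
  by_cases htop : g.edist hg x y = ⊤
  · rw [htop]; exact le_top
  -- for every `δ > 0`, `|√(f x + δ) - √(f y + δ)| ≤ ½ d(x, y)`
  have key : ∀ δ : ℝ, 0 < δ →
      |Real.sqrt (f x + δ) - Real.sqrt (f y + δ)| ≤ (1 / 2 : ℝ) * (g.edist hg x y).toReal := by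
    intro δ hδ
    have hF : ContMDiffOn I 𝓘(ℝ, ℝ) 1 (fun z ↦ Real.sqrt (f z + δ)) univ := by
      intro z _
      have hpos : 0 < f z + δ := by linarith [hf0 z]
      have h1 : ContMDiffAt I 𝓘(ℝ, ℝ) 1 (fun z ↦ f z + δ) z := (hf z).add contMDiffAt_const
      have h2 : ContDiffAt ℝ 1 Real.sqrt (f z + δ) := Real.contDiffAt_sqrt hpos.ne'
      exact (ContDiffAt.comp_contMDiffAt (g := Real.sqrt) (f := fun z ↦ f z + δ) (x := z)
        h2 h1).contMDiffWithinAt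
    have hL : ∀ z ∈ (univ : Set M), ∀ v : TangentSpace I z,
        |mvfderiv I (fun z ↦ Real.sqrt (f z + δ)) z v| ≤
          ((1 / 2 : ℝ≥0) : ℝ) * Real.sqrt (g.val z v v) := by
      intro z _ v
      have h := abs_mvfderiv_sqrt_add_le g hg ((hf z).mdifferentiableAt one_ne_zero) (hgrad z) hδ v
      have hc : ((1 / 2 : ℝ≥0) : ℝ) = 1 / 2 := by norm_num
      rwa [hc]
    have hball : y ∈ g.ball x ⊤ := by
      rw [PseudoRiemannianMetric.mem_ball, PseudoRiemannianMetric.riemEDist_eq hg]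
      exact Ne.lt_top htop
    have h := ofReal_abs_sub_le_mul_riemEDist g hg isOpen_univ hF hL (subset_univ _) hball
    rw [PseudoRiemannianMetric.riemEDist_eq hg] at h
    have hne : ((1 / 2 : ℝ≥0) : ℝ≥0∞) * g.edist hg x y ≠ ⊤ := ENNReal.mul_ne_top ENNReal.coe_ne_top htop
    have h2 := (ENNReal.ofReal_le_iff_le_toReal hne).1 h
    rw [ENNReal.toReal_mul] at h2
    have hc : (((1 / 2 : ℝ≥0) : ℝ≥0∞)).toReal = 1 / 2 := by norm_num
    rwa [hc] at h2
  -- pass to the limit `δ → 0`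
  have hmain : Real.sqrt (f y) - Real.sqrt (f x) ≤ (1 / 2 : ℝ) * (g.edist hg x y).toReal := by
    refine le_of_forall_pos_le_add fun ε hε ↦ ?_
    have hk := key (ε ^ 2) (by positivity)
    have h1 : Real.sqrt (f y) ≤ Real.sqrt (f y + ε ^ 2) :=
      Real.sqrt_le_sqrt (by nlinarith)
    have h2 : Real.sqrt (f x + ε ^ 2) ≤ Real.sqrt (f x) + ε := by
      have := sqrt_add_le_sqrt_add_sqrt (hf0 x) (sq_nonneg ε)
      rwa [Real.sqrt_sq hε.le] at this
    have h3 : Real.sqrt (f y + ε ^ 2) - Real.sqrt (f x + ε ^ 2) ≤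
        (1 / 2 : ℝ) * (g.edist hg x y).toReal := by
      have := neg_abs_le (Real.sqrt (f x + ε ^ 2) - Real.sqrt (f y + ε ^ 2))
      linarith
    linarith
  calc ENNReal.ofReal (2 * (Real.sqrt (f y) - Real.sqrt (f x)))
      ≤ ENNReal.ofReal ((g.edist hg x y).toReal) := ENNReal.ofReal_le_ofReal (by linarith)
    _ = g.edist hg x y := ENNReal.ofReal_toReal htop

/-- **The upper growth bound from the Lipschitz bound** (Haslhofer–Müller 2011, App., proof of
Lemma 2.1: (2.quadgrowth), upper half, "follows from (2.lipschitz) … by setting `y = p`"): for a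
Riemannian `g` and a `C¹` function with `|∇f|²_g ≤ f`, if `d(p, x) ≤ r` then
`f(x) ≤ ¼ (r + 2√f(p))²`. [cite: HaslhoferMuller2011, App., proof of Lemma 2.1 (p. 15)] -/
theorem le_quarter_sq_of_edist_le (hg : g.IsRiemannian) {f : M → ℝ}
    (hf : ContMDiff I 𝓘(ℝ, ℝ) 1 f) (hgrad : ∀ x, g.gradSq f x ≤ f x) {p x : M} {r : ℝ≥0}
    (hr : g.edist hg p x ≤ r) :
    f x ≤ (1 / 4 : ℝ) * ((r : ℝ) + 2 * Real.sqrt (f p)) ^ 2 := by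
  have hf0 : ∀ z, 0 ≤ f z := fun z ↦ (g.gradSq_nonneg hg f z).trans (hgrad z)
  have h1 := (ofReal_two_mul_sqrt_sub_sqrt_le_edist g hg hf hgrad p x).trans hr
  rw [← ENNReal.ofReal_coe_nnreal, ENNReal.ofReal_le_ofReal_iff r.coe_nonneg] at h1
  have h2 : Real.sqrt (f x) ≤ (r : ℝ) / 2 + Real.sqrt (f p) := by linarith
  have h3 : 0 ≤ (r : ℝ) / 2 + Real.sqrt (f p) := by positivity
  calc f x = Real.sqrt (f x) ^ 2 := (Real.sq_sqrt (hf0 x)).symm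
    _ ≤ ((r : ℝ) / 2 + Real.sqrt (f p)) ^ 2 := pow_le_pow_left₀ (Real.sqrt_nonneg _) h2 2
    _ = (1 / 4 : ℝ) * ((r : ℝ) + 2 * Real.sqrt (f p)) ^ 2 := by ring

end Lipschitz

/-! ### (2.Rpest), (2.fcest): the potential at a minimum point -/

section Minimum

variable {E : Type*} [NormedAddCommGroup E] [NormedSpace ℝ E] [FiniteDimensional ℝ E]
  [CompleteSpace E] {H : Type*} [TopologicalSpace H] {I : ModelWithCorners ℝ E H} [I.Boundaryless]
  {M : Type*} [TopologicalSpace M] [ChartedSpace H M] [IsManifold I ∞ M]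
  (g : PseudoRiemannianMetric I ∞ E (TangentSpace I : M → Type _)) [g.HasLeviCivita]

omit [CompleteSpace E] [g.HasLeviCivita] in
/-- At a local minimum of a function on a manifold without boundary the gradient square
vanishes: `|∇f|²_g(p) = 0` (Fermat: `df_p = 0`). [folklore] -/
theorem gradSq_eq_zero_of_isLocalMin {f : M → ℝ} {p : M} (hmin : IsLocalMin f p) :
    g.gradSq f p = 0 := by
  have hcrit : mfderiv I 𝓘(ℝ, ℝ) f p = 0 :=
    Literature.Topology.FourManifolds.IsLocalMin.isMCriticalPt (I := I) hmin
  refine g.gradSq_eq_zero_of_mvfderiv_eq_zero ?_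
  ext v
  simp [mvfderiv, hcrit]

omit [CompleteSpace E] in
/-- **`f(p) + C₁ = R(p)` at a critical point** (Haslhofer–Müller 2011, App., proof of Lemma 2.1:
"Using this and `∇f(p) = 0`, equation (2.5) implies …"), here `C₁ = 0`: for a potential
normalised by `R + |∇f|² = f`, at a local minimum `p` of `f` one has `f(p) = R(p)`.
[cite: HaslhoferMuller2011, App., proof of Lemma 2.1, (2.fcest) (p. 15)] -/
theorem potential_eq_scalarCurvature_of_isLocalMin {f : M → ℝ}
    (hnorm : ∀ x : M, g.scalarCurvature x + g.gradSq f x = f x) {p : M} (hmin : IsLocalMin f p) :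
    f p = g.scalarCurvature p := by
  have h := hnorm p
  rw [gradSq_eq_zero_of_isLocalMin g hmin, add_zero] at h
  exact h.symm

/-- **`R(p) = f(p) + C₁ ≤ n/2` at a minimum point** (Haslhofer–Müller 2011, App., proof of
Lemma 2.1, (2.Rpest)–(2.fcest): "Since `Δf(p) ≥ 0`, (2.3) [`R + Δf = n/2`] … imply
`R(p) ≤ n/2` … `f(p) + C₁ ≤ n/2`"), here `C₁ = 0` and `n = dim M = finrank ℝ E`: for a Riemannian
gradient shrinker `Ric + Hess f = g/2` with `R + |∇f|² = f` and `f` of class `C²`, at every local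
minimum `p` of `f`, `f(p) ≤ n/2`. (The lower bound `0 ≤ f(p)` of (2.fcest) is `R(p) ≥ 0`, (2.6).)
[cite: HaslhoferMuller2011, App., proof of Lemma 2.1, (2.Rpest)–(2.fcest) (p. 15)] -/
theorem potential_le_half_dim_of_isLocalMin (hg : g.IsRiemannian) {f : M → ℝ}
    (hf : ContMDiff I 𝓘(ℝ, ℝ) 2 f)
    (hsol : ∀ (x : M) (X Y : TangentSpace I x),
      g.ricci x X Y + g.hessian f x X Y = (1 / 2 : ℝ) * g.val x X Y)
    (hnorm : ∀ x : M, g.scalarCurvature x + g.gradSq f x = f x) {p : M} (hmin : IsLocalMin f p) :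
    f p ≤ (finrank ℝ E : ℝ) / 2 := by
  have hshr : g.IsGradientShrinker f 1 := (g.isGradientShrinker_one_iff f).2 hsol
  have htrace := hshr.scalarCurvature_add_dalembertian p
  have hΔ : 0 ≤ g.dalembertian f p := g.dalembertian_nonneg_of_isLocalMin (hf p) hmin (hg p)
  rw [potential_eq_scalarCurvature_of_isLocalMin g hnorm hmin]
  have h2 : (finrank ℝ E : ℝ) * (1 / (2 * 1)) = (finrank ℝ E : ℝ) / 2 := by ring
  linarith

end Minimum

/-! ### Lemma 2.1, upper half, given (2.6) -/

section Upper

variable {E : Type*} [NormedAddCommGroup E] [NormedSpace ℝ E] [FiniteDimensional ℝ E]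
  [CompleteSpace E] {H : Type*} [TopologicalSpace H] {I : ModelWithCorners ℝ E H} [I.Boundaryless]
  {M : Type*} [TopologicalSpace M] [ChartedSpace H M] [IsManifold I ∞ M]
  (g : PseudoRiemannianMetric I ∞ E (TangentSpace I : M → Type _)) [g.HasLeviCivita]

omit [CompleteSpace E] [I.Boundaryless] in
/-- (2.dfbound): `R ≥ 0` and `R + |∇f|² = f` give `|∇f|² ≤ f`.
[cite: HaslhoferMuller2011, App., proof of Lemma 2.1, (2.dfbound) (p. 15)] -/
theorem gradSq_le_potential_of_scalarCurvature_nonneg {f : M → ℝ}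
    (hR : ∀ x : M, 0 ≤ g.scalarCurvature x)
    (hnorm : ∀ x : M, g.scalarCurvature x + g.gradSq f x = f x) (x : M) :
    g.gradSq f x ≤ f x := by
  linarith [hR x, hnorm x]

/-- **Haslhofer–Müller 2011, Lemma 2.1, upper half, given (2.6).** For a Riemannian gradient
shrinker `Ric + Hess f = g/2` (any model space `E`, `n = finrank ℝ E`, manifold without boundary)
with smooth potential normalised by `R + |∇f|² = f` and with `R ≥ 0` everywhere, and a minimum
point `p` of `f`: if `d(p, x) ≤ r` then `f(x) ≤ ¼ (r + √(2n))²` — the printed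
`f(x) + C₁ ≤ ¼ (d(x,p) + √(2n))²` with `C₁ = 0`, from (2.lipschitz) at `y = p` and
`2√(f(p)) ≤ 2√(n/2) = √(2n)` ((2.fcest)). This is the upper clause of conjunct (b) of
`shrinkerPotentialGrowth`, modulo its conjunct (a).
[cite: HaslhoferMuller2011, Lemma 2.1 and App., proof of Lemma 2.1 (pp. 5, 15)] -/
theorem potential_le_of_scalarCurvature_nonneg (hg : g.IsRiemannian) {f : M → ℝ}
    (hf : ContMDiff I 𝓘(ℝ, ℝ) ∞ f)
    (hsol : ∀ (x : M) (X Y : TangentSpace I x),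
      g.ricci x X Y + g.hessian f x X Y = (1 / 2 : ℝ) * g.val x X Y)
    (hnorm : ∀ x : M, g.scalarCurvature x + g.gradSq f x = f x)
    (hR : ∀ x : M, 0 ≤ g.scalarCurvature x) {p : M} (hp : ∀ x : M, f p ≤ f x)
    (x : M) (r : ℝ≥0) (hr : g.edist hg p x ≤ r) :
    f x ≤ (1 / 4 : ℝ) * ((r : ℝ) + Real.sqrt (2 * (finrank ℝ E : ℝ))) ^ 2 := by
  have hgrad := gradSq_le_potential_of_scalarCurvature_nonneg g hR hnorm
  have hmin : IsLocalMin f p := Filter.Eventually.of_forall fun y ↦ hp y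
  have hfp : f p ≤ (finrank ℝ E : ℝ) / 2 :=
    potential_le_half_dim_of_isLocalMin g hg (hf.of_le (by norm_cast)) hsol hnorm hmin
  have hfp0 : 0 ≤ f p := (g.gradSq_nonneg hg f p).trans (hgrad p)
  have h1 := le_quarter_sq_of_edist_le g hg (hf.of_le (by norm_cast)) hgrad hr
  have h4 : Real.sqrt 4 = 2 := by
    rw [show (4 : ℝ) = 2 ^ 2 by norm_num, Real.sqrt_sq (by norm_num : (0 : ℝ) ≤ 2)]
  have h2 : 2 * Real.sqrt (f p) ≤ Real.sqrt (2 * (finrank ℝ E : ℝ)) :=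
    calc 2 * Real.sqrt (f p) = Real.sqrt (4 * f p) := by
          rw [Real.sqrt_mul (by norm_num : (0 : ℝ) ≤ 4), h4]
      _ ≤ Real.sqrt (2 * (finrank ℝ E : ℝ)) := Real.sqrt_le_sqrt (by linarith)
  have h3 : 0 ≤ (r : ℝ) + 2 * Real.sqrt (f p) := by positivity
  calc f x ≤ (1 / 4 : ℝ) * ((r : ℝ) + 2 * Real.sqrt (f p)) ^ 2 := h1
    _ ≤ (1 / 4 : ℝ) * ((r : ℝ) + Real.sqrt (2 * (finrank ℝ E : ℝ))) ^ 2 :=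
        mul_le_mul_of_nonneg_left (pow_le_pow_left₀ h3 (by linarith) 2) (by norm_num)

end Upper

/-! ### Assembly: `shrinkerPotentialGrowth` from (2.6), the lower half of Lemma 2.1, and Lemma 2.2 -/

section Assembly

/-- **Reduction of the named fact to its three unproved inputs.** `shrinkerPotentialGrowth`
(Haslhofer–Müller 2011, §2: (2.6), Lemma 2.1, Lemma 2.2, normalisation `C₁ = 0`) follows from
(A) (2.6) `R ≥ 0` on every complete connected normalised gradient shrinker [Zha09];
(L) the existence of a minimum point `p` of `f` together with the lower growth bound
`¼ (d(x,p) − 5n)₊² ≤ f(x)` (App., (2.distancebound): second variation along minimizing geodesics);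
(V) Lemma 2.2, `Vol B_r(p) ≤ C₂(n) rⁿ` about every minimum point `p` (App., p. 15–16) —
the upper growth bound being supplied by `potential_le_of_scalarCurvature_nonneg`. The three
inputs enter as hypotheses, stated over exactly the data of the fact; this is NOT a discharge.
[cite: HaslhoferMuller2011, §2 (2.6), Lemma 2.1, Lemma 2.2 (p. 5); App. (p. 15)] -/
theorem shrinkerPotentialGrowth_of_nonneg_of_lower_of_volume
    (hA : ∀ (n : ℕ) (M : Type) [TopologicalSpace M] [T2Space M] [SecondCountableTopology M]
      [ChartedSpace (EuclideanSpace ℝ (Fin n)) M] [IsManifold (𝓡 n) ∞ M] [ConnectedSpace M]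
      [T3Space M] [MeasurableSpace M] [BorelSpace M]
      (g : PseudoRiemannianMetric (𝓡 n) ∞ (EuclideanSpace ℝ (Fin n)) (TangentSpace (𝓡 n) : M → Type _))
      [g.HasLeviCivita] (f : M → ℝ) (hg : g.IsRiemannian),
      (∀ (x : M) (r : NNReal), IsCompact {y : M | g.edist hg x y ≤ r}) →
      ContMDiff (𝓡 n) 𝓘(ℝ, ℝ) ∞ f →
      (∀ (x : M) (X Y : TangentSpace (𝓡 n) x),
        g.ricci x X Y + g.hessian f x X Y = (1 / 2 : ℝ) * g.val x X Y) →
      (∀ x : M, g.scalarCurvature x + g.gradSq f x = f x) →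
      ∀ x : M, 0 ≤ g.scalarCurvature x)
    (hL : ∀ (n : ℕ) (M : Type) [TopologicalSpace M] [T2Space M] [SecondCountableTopology M]
      [ChartedSpace (EuclideanSpace ℝ (Fin n)) M] [IsManifold (𝓡 n) ∞ M] [ConnectedSpace M]
      [T3Space M] [MeasurableSpace M] [BorelSpace M]
      (g : PseudoRiemannianMetric (𝓡 n) ∞ (EuclideanSpace ℝ (Fin n)) (TangentSpace (𝓡 n) : M → Type _))
      [g.HasLeviCivita] (f : M → ℝ) (hg : g.IsRiemannian),
      (∀ (x : M) (r : NNReal), IsCompact {y : M | g.edist hg x y ≤ r}) →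
      ContMDiff (𝓡 n) 𝓘(ℝ, ℝ) ∞ f →
      (∀ (x : M) (X Y : TangentSpace (𝓡 n) x),
        g.ricci x X Y + g.hessian f x X Y = (1 / 2 : ℝ) * g.val x X Y) →
      (∀ x : M, g.scalarCurvature x + g.gradSq f x = f x) →
      ∃ p : M, (∀ x : M, f p ≤ f x) ∧
        ∀ (x : M) (r : NNReal), (r : ℝ≥0∞) ≤ g.edist hg p x →
          (1 / 4 : ℝ) * (max ((r : ℝ) - 5 * n) 0) ^ 2 ≤ f x)
    (hV : ∀ n : ℕ, ∃ C₂ : ℝ, ∀ (M : Type) [TopologicalSpace M] [T2Space M]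
      [SecondCountableTopology M] [ChartedSpace (EuclideanSpace ℝ (Fin n)) M]
      [IsManifold (𝓡 n) ∞ M] [ConnectedSpace M] [T3Space M] [MeasurableSpace M] [BorelSpace M]
      (g : PseudoRiemannianMetric (𝓡 n) ∞ (EuclideanSpace ℝ (Fin n)) (TangentSpace (𝓡 n) : M → Type _))
      [g.HasLeviCivita] (f : M → ℝ) (hg : g.IsRiemannian),
      (∀ (x : M) (r : NNReal), IsCompact {y : M | g.edist hg x y ≤ r}) →
      ContMDiff (𝓡 n) 𝓘(ℝ, ℝ) ∞ f →
      (∀ (x : M) (X Y : TangentSpace (𝓡 n) x),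
        g.ricci x X Y + g.hessian f x X Y = (1 / 2 : ℝ) * g.val x X Y) →
      (∀ x : M, g.scalarCurvature x + g.gradSq f x = f x) →
      ∀ p : M, (∀ x : M, f p ≤ f x) →
        ∀ r : NNReal, riemannianMeasure (g.toContMDiffRiemannianMetric hg)
          {x : M | g.edist hg p x < r} ≤ ENNReal.ofReal (C₂ * (r : ℝ) ^ n)) :
    shrinkerPotentialGrowth := by
  intro n
  obtain ⟨C₂, hC₂⟩ := hV n
  refine ⟨C₂, ?_⟩
  intro M _ _ _ _ _ _ _ _ _ g _ f hg hcpt hf hsol hnorm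
  have hR := hA n M g f hg hcpt hf hsol hnorm
  obtain ⟨p, hp, hlow⟩ := hL n M g f hg hcpt hf hsol hnorm
  refine ⟨hR, p, hp, hlow, fun x r hr ↦ ?_, hC₂ M g f hg hcpt hf hsol hnorm p hp⟩
  have h := potential_le_of_scalarCurvature_nonneg g hg hf hsol hnorm hR hp x r hr
  rwa [finrank_euclideanSpace_fin] at h

end Assembly

/-! ### The matrix Riccati layer: the index inequality for the trapezoid test function -/

section MatrixLayer

open Matrix

open scoped Matrix.Norms.Operator

variable {ι : Type*} [Fintype ι] [DecidableEq ι]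

/-- The algebraic step `2φφ'ψ - φ²ψ²/m ≤ m φ'²` (`0 ≤ (φψ - mφ')²`) in the completion of the
square behind every Riccati comparison argument. [folklore] -/
theorem two_mul_mul_sub_le {φ φ' ψ m : ℝ} (hm : 0 < m) :
    2 * φ * φ' * ψ - φ ^ 2 * ψ ^ 2 / m ≤ m * φ' ^ 2 := by
  have key : (2 * φ * φ' * ψ - φ ^ 2 * ψ ^ 2 / m) * m ≤ (m * φ' ^ 2) * m := by
    rw [sub_mul, div_mul_cancel₀ _ hm.ne']
    nlinarith [sq_nonneg (φ * ψ - m * φ')]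
  exact le_of_mul_le_mul_right key hm

/-- **One `C¹` piece of the index inequality along a Jacobi tensor** (the matrix Riccati layer
of Chavel 2006, Thm. III.4.3, (III.4.16)–(III.4.18), read for a test function): if `𝒜'' + ℛ𝒜 = 0`
on `(a, b) ∋ 0` with `ℛ` symmetric, `𝒜(0) = 0`, `det 𝒜 ≠ 0` on `(0, b)`, `tr ℛ = ρ` on `(0, b)`,
and `φ` is `C¹` on `[c, d] ⊆ (0, b)` with `ρ` continuous there, then with `𝒰 = 𝒜'𝒜⁻¹`
(symmetric, `(tr 𝒰)' + tr 𝒰² + tr ℛ = 0`, `tr 𝒰² ≥ (tr 𝒰)²/m`, `m` the size of the matrices)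
`∫_c^d φ²ρ ≤ m ∫_c^d φ'² − [φ² tr 𝒰]_c^d` — from `(φ² tr 𝒰)' = 2φφ' tr 𝒰 − φ²(tr ℛ + tr 𝒰²)
≤ m φ'² − φ² ρ` and the fundamental theorem of calculus in inequality form. This is the
"second variation formula for the energy" step of Haslhofer–Müller 2011, App., proof of
Lemma 2.1, in the Jacobi-tensor form available in the tree (`VolumeSphereTheoremProofs.lean`, §8).
[cite: Chavel2006, §III.4, Thm. III.4.3 (III.4.16)–(III.4.18)]
[cite: HaslhoferMuller2011, App., proof of Lemma 2.1 (p. 15)] -/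
theorem jacobi_index_piece [Nonempty ι] {A A' R : ℝ → Matrix ι ι ℝ} {a b : ℝ}
    (h0 : (0 : ℝ) ∈ Ioo a b)
    (hA : ∀ t ∈ Ioo a b, HasDerivAt A (A' t) t)
    (hA' : ∀ t ∈ Ioo a b, HasDerivAt A' (-(R t * A t)) t)
    (hR : ∀ t ∈ Ioo a b, (R t).IsSymm) (hA0 : A 0 = 0)
    (hdet : ∀ t ∈ Ioo 0 b, (A t).det ≠ 0)
    {ρ : ℝ → ℝ} (hρ : ∀ t ∈ Ioo 0 b, (R t).trace = ρ t)
    {c d : ℝ} (hc : 0 < c) (hcd : c ≤ d) (hdb : d < b) (hρc : ContinuousOn ρ (Icc c d))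
    {φ φ' : ℝ → ℝ} (hφ : ∀ t ∈ Icc c d, HasDerivAt φ (φ' t) t)
    (hφ'c : ContinuousOn φ' (Icc c d)) :
    ∫ t in c..d, φ t ^ 2 * ρ t ≤ Fintype.card ι * (∫ t in c..d, φ' t ^ 2) -
      (φ d ^ 2 * (A' d * (A d)⁻¹).trace - φ c ^ 2 * (A' c * (A c)⁻¹).trace) := by
  set m : ℝ := (Fintype.card ι : ℝ) with hm_def
  have hm : 0 < m := by rw [hm_def]; exact_mod_cast Fintype.card_pos
  set ψ : ℝ → ℝ := fun t ↦ (A' t * (A t)⁻¹).trace with hψ_def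
  -- every parameter of `[c, d]` is a good parameter
  have hIab : ∀ t ∈ Icc c d, t ∈ Ioo a b := fun t ht ↦
    ⟨h0.1.trans (hc.trans_le ht.1), ht.2.trans_lt hdb⟩
  have hI0b : ∀ t ∈ Icc c d, t ∈ Ioo 0 b := fun t ht ↦ ⟨hc.trans_le ht.1, ht.2.trans_lt hdb⟩
  have hunit : ∀ t ∈ Icc c d, IsUnit (A t).det := fun t ht ↦
    isUnit_iff_ne_zero.2 (hdet t (hI0b t ht))
  -- the traced Riccati equation and the symmetry of the shape operator
  have hψ : ∀ t ∈ Icc c d, HasDerivAt ψ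
      (-(R t).trace - ((A' t * (A t)⁻¹) * (A' t * (A t)⁻¹)).trace) t := fun t ht ↦
    hasDerivAt_trace_shape (hA t (hIab t ht)) (hA' t (hIab t ht)) (hunit t ht)
  have hUsymm : ∀ t ∈ Icc c d, (A' t * (A t)⁻¹).IsSymm := fun t ht ↦
    isSymm_mul_inv_of_wronskian_eq_zero
      (jacobi_wronskian_eq_zero h0 hA hA' hR hA0 t (hIab t ht)) (hunit t ht)
  -- the function `h = φ² ψ` and its derivative bound
  set h : ℝ → ℝ := fun t ↦ φ t ^ 2 * ψ t with hh_def
  set h' : ℝ → ℝ := fun t ↦ 2 * φ t * φ' t * ψ t +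
    φ t ^ 2 * (-(R t).trace - ((A' t * (A t)⁻¹) * (A' t * (A t)⁻¹)).trace) with hh'_def
  have hh : ∀ t ∈ Icc c d, HasDerivAt h (h' t) t := by
    intro t ht
    have h1 : HasDerivAt (fun s ↦ φ s ^ 2) (2 * φ t * φ' t) t := by
      have h := (hasDerivAt_pow 2 (φ t)).comp t (hφ t ht)
      have h' : HasDerivAt (fun s ↦ φ s ^ 2) ((2 : ℕ) * φ t ^ (2 - 1) * φ' t) t := h
      convert h' using 1
      push_cast
      ring
    exact h1.mul (hψ t ht)
  set G : ℝ → ℝ := fun t ↦ m * φ' t ^ 2 - φ t ^ 2 * ρ t with hG_def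
  have hbound : ∀ t ∈ Ioo c d, h' t ≤ G t := by
    intro t ht
    have ht' : t ∈ Icc c d := Ioo_subset_Icc_self ht
    have hρt : (R t).trace = ρ t := hρ t (hI0b t ht')
    have halg := two_mul_mul_sub_le (φ := φ t) (φ' := φ' t) (ψ := ψ t) hm
    set T : ℝ := ((A' t * (A t)⁻¹) * (A' t * (A t)⁻¹)).trace with hT_def
    have hsq : (ψ t) ^ 2 / m ≤ T := by
      have h1 := sq_trace_le_card_mul_trace_mul_self (hUsymm t ht')
      rw [div_le_iff₀ hm]
      have h2 : (ψ t) ^ 2 = (A' t * (A t)⁻¹).trace ^ 2 := rfl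
      rw [h2, hT_def, hm_def]
      linarith
    have hφ2 : 0 ≤ φ t ^ 2 := sq_nonneg _
    have h3 : φ t ^ 2 * (ψ t ^ 2 / m) ≤ φ t ^ 2 * T := mul_le_mul_of_nonneg_left hsq hφ2
    have h4 : φ t ^ 2 * (ψ t ^ 2 / m) = φ t ^ 2 * ψ t ^ 2 / m := by ring
    show 2 * φ t * φ' t * ψ t + φ t ^ 2 * (-(R t).trace - T) ≤ m * φ' t ^ 2 - φ t ^ 2 * ρ t
    rw [hρt]
    linarith
  -- continuity and integrability
  have hφc : ContinuousOn φ (Icc c d) := fun t ht ↦ (hφ t ht).continuousAt.continuousWithinAt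
  have hψc : ContinuousOn ψ (Icc c d) := fun t ht ↦ (hψ t ht).continuousAt.continuousWithinAt
  have hhc : ContinuousOn h (Icc c d) := (hφc.pow 2).mul hψc
  have hGc : ContinuousOn G (Icc c d) :=
    (continuousOn_const.mul (hφ'c.pow 2)).sub ((hφc.pow 2).mul hρc)
  have hGi : IntegrableOn G (Icc c d) := hGc.integrableOn_Icc
  have hFTC := intervalIntegral.sub_le_integral_of_hasDeriv_right_of_le hcd hhc
    (fun t ht ↦ (hh t (Ioo_subset_Icc_self ht)).hasDerivWithinAt) hGi hbound
  -- split the integral of `G`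
  have hi1 : IntervalIntegrable (fun t ↦ m * φ' t ^ 2) volume c d := by
    refine ContinuousOn.intervalIntegrable ?_
    rw [uIcc_of_le hcd]
    exact continuousOn_const.mul (hφ'c.pow 2)
  have hi2 : IntervalIntegrable (fun t ↦ φ t ^ 2 * ρ t) volume c d := by
    refine ContinuousOn.intervalIntegrable ?_
    rw [uIcc_of_le hcd]
    exact (hφc.pow 2).mul hρc
  have hsplit : ∫ t in c..d, G t =
      m * (∫ t in c..d, φ' t ^ 2) - ∫ t in c..d, φ t ^ 2 * ρ t := by
    rw [← intervalIntegral.integral_const_mul, ← intervalIntegral.integral_sub hi1 hi2]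
  rw [hsplit] at hFTC
  have hhd : h d = φ d ^ 2 * (A' d * (A d)⁻¹).trace := rfl
  have hhc' : h c = φ c ^ 2 * (A' c * (A c)⁻¹).trace := rfl
  rw [hhd, hhc'] at hFTC
  linarith

/-- **The index inequality for Haslhofer–Müller's trapezoid test function, matrix form**
(Haslhofer–Müller 2011, App., proof of Lemma 2.1: "let `φ(s) = s` on `[0,1]`, `1` on
`[1, s₀-1]`, `s₀ - s` on `[s₀-1, s₀]`. By the second variation formula for the energy of `γ`,
`∫₀^{s₀} φ² Rc(γ',γ') ds ≤ (n-1) ∫₀^{s₀} φ'² ds = 2n - 2`"): along a Jacobi tensor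
`𝒜'' + ℛ𝒜 = 0`, `𝒜(0) = 0`, `𝒜'(0) = I`, `ℛ` symmetric and continuous at `0`, with no conjugate
point on `(0, b)` (`det 𝒜 ≠ 0`), for `2 < L < b` and `ρ = tr ℛ` continuous on `[0, L]`:
`∫₀¹ t²ρ + ∫₁^{L-1} ρ + ∫_{L-1}^L (L-t)²ρ ≤ 2m` (`m` the size of the matrices, i.e. `n - 1`).
Proof: `jacobi_index_piece` on `[ε,1]`, `[1,L-1]`, `[L-1,L]`; the boundary terms telescope to
`ε² tr 𝒰(ε) → 0` (`tr 𝒰 ∼ m/t`, `jacobi_tendsto_trace_shape_sub_div`), `ε → 0⁺`. For empty index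
type both sides vanish. [cite: HaslhoferMuller2011, App., proof of Lemma 2.1 (p. 15)]
[cite: Chavel2006, §III.4, Thm. III.4.3 (proof)] -/
theorem jacobi_index_trapezoid {A A' R : ℝ → Matrix ι ι ℝ} {a b : ℝ} (h0 : (0 : ℝ) ∈ Ioo a b)
    (hA : ∀ t ∈ Ioo a b, HasDerivAt A (A' t) t)
    (hA' : ∀ t ∈ Ioo a b, HasDerivAt A' (-(R t * A t)) t)
    (hR : ∀ t ∈ Ioo a b, (R t).IsSymm) (hRc : ContinuousAt R 0)
    (hA0 : A 0 = 0) (hA'0 : A' 0 = 1) (hdet : ∀ t ∈ Ioo 0 b, (A t).det ≠ 0)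
    {ρ : ℝ → ℝ} (hρ : ∀ t ∈ Ioo 0 b, (R t).trace = ρ t) {L : ℝ} (hL : 2 < L) (hLb : L < b)
    (hρc : ContinuousOn ρ (Icc 0 L)) :
    (∫ t in (0:ℝ)..1, t ^ 2 * ρ t) + (∫ t in (1:ℝ)..(L - 1), ρ t) +
        ∫ t in (L - 1)..L, (L - t) ^ 2 * ρ t ≤ 2 * Fintype.card ι := by
  rcases isEmpty_or_nonempty ι with hι | hι
  · -- all traces vanish: both sides are `0`
    have hρ0 : ∀ t ∈ Ioo 0 b, ρ t = 0 := fun t ht ↦ by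
      rw [← hρ t ht]
      simp [Matrix.trace]
    have h1 : ∫ t in (0:ℝ)..1, t ^ 2 * ρ t = ∫ t in (0:ℝ)..1, (0:ℝ) := by
      refine intervalIntegral.integral_congr fun t ht ↦ ?_
      rw [uIcc_of_le zero_le_one] at ht
      rcases ht.1.eq_or_lt with h | h
      · rw [← h]; simp
      · simp [hρ0 t ⟨h, by linarith [ht.2]⟩]
    have h2 : ∫ t in (1:ℝ)..(L - 1), ρ t = ∫ t in (1:ℝ)..(L - 1), (0:ℝ) := by
      refine intervalIntegral.integral_congr fun t ht ↦ ?_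
      rw [uIcc_of_le (by linarith)] at ht
      exact hρ0 t ⟨by linarith [ht.1], by linarith [ht.2]⟩
    have h3 : ∫ t in (L - 1)..L, (L - t) ^ 2 * ρ t = ∫ t in (L - 1)..L, (0:ℝ) := by
      refine intervalIntegral.integral_congr fun t ht ↦ ?_
      rw [uIcc_of_le (by linarith)] at ht
      simp [hρ0 t ⟨by linarith [ht.1], by linarith [ht.2]⟩]
    rw [h1, h2, h3, Fintype.card_eq_zero]
    simp
  -- the nonempty case
  set m : ℝ := (Fintype.card ι : ℝ) with hm_def
  set ψ : ℝ → ℝ := fun t ↦ (A' t * (A t)⁻¹).trace with hψ_def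
  -- the three pieces, for `0 < ε < 1`
  have hP1 : ∀ ε ∈ Ioo (0:ℝ) 1,
      ∫ t in ε..1, t ^ 2 * ρ t ≤ m * (1 - ε) - (ψ 1 - ε ^ 2 * ψ ε) := by
    intro ε hε
    have h := jacobi_index_piece h0 hA hA' hR hA0 hdet hρ hε.1 hε.2.le (by linarith)
      (hρc.mono (Icc_subset_Icc hε.1.le (by linarith))) (φ := fun t ↦ t) (φ' := fun _ ↦ (1:ℝ))
      (fun t _ ↦ hasDerivAt_id t) continuousOn_const
    have hi : ∫ t in ε..1, (fun _ ↦ (1:ℝ)) t ^ 2 = 1 - ε := by simp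
    rw [hi] at h
    simpa [hψ_def] using h
  have hP2 : ∫ t in (1:ℝ)..(L - 1), ρ t ≤ -(ψ (L - 1) - ψ 1) := by
    have h := jacobi_index_piece h0 hA hA' hR hA0 hdet hρ (c := 1) (d := L - 1) one_pos
      (by linarith) (by linarith)
      (hρc.mono (Icc_subset_Icc zero_le_one (by linarith))) (φ := fun _ ↦ (1:ℝ))
      (φ' := fun _ ↦ (0:ℝ)) (fun t _ ↦ hasDerivAt_const t 1) continuousOn_const
    have hi : ∫ t in (1:ℝ)..(L - 1), (fun _ ↦ (0:ℝ)) t ^ 2 = 0 := by simp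
    rw [hi] at h
    simpa [hψ_def] using h
  have hP3 : ∫ t in (L - 1)..L, (L - t) ^ 2 * ρ t ≤ m * 1 - (0 - ψ (L - 1)) := by
    have h := jacobi_index_piece h0 hA hA' hR hA0 hdet hρ (c := L - 1) (d := L) (by linarith)
      (by linarith) hLb (hρc.mono (Icc_subset_Icc (by linarith) le_rfl)) (φ := fun t ↦ L - t)
      (φ' := fun _ ↦ (-1:ℝ)) (fun t _ ↦ (hasDerivAt_id t).const_sub L) continuousOn_const
    have hi : ∫ t in (L - 1)..L, (fun _ ↦ (-1:ℝ)) t ^ 2 = 1 := by simp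
    rw [hi] at h
    simpa [hψ_def] using h
  -- the sum, for `0 < ε < 1`
  have hsum : ∀ ε ∈ Ioo (0:ℝ) 1,
      (∫ t in ε..1, t ^ 2 * ρ t) + (∫ t in (1:ℝ)..(L - 1), ρ t) +
        ∫ t in (L - 1)..L, (L - t) ^ 2 * ρ t ≤ 2 * m - m * ε + ε ^ 2 * ψ ε := by
    intro ε hε
    have h1 := hP1 ε hε
    linarith
  -- the limit `ε → 0⁺` of the left-hand side
  have hint : IntervalIntegrable (fun t : ℝ ↦ t ^ 2 * ρ t) volume 0 1 := by
    refine ContinuousOn.intervalIntegrable ?_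
    rw [uIcc_of_le zero_le_one]
    exact (continuousOn_id.pow 2).mul (hρc.mono (Icc_subset_Icc le_rfl (by linarith)))
  have hLHS : Tendsto (fun ε ↦ ∫ t in ε..1, t ^ 2 * ρ t) (𝓝[>] 0)
      (𝓝 (∫ t in (0:ℝ)..1, t ^ 2 * ρ t)) := by
    have hc := intervalIntegral.continuousOn_primitive_interval' hint.symm
      (show (1:ℝ) ∈ uIcc 1 0 from left_mem_uIcc)
    -- `∫_ε^1 = -∫_1^ε`
    have heq : ∀ ε, ∫ t in ε..1, t ^ 2 * ρ t = -∫ t in (1:ℝ)..ε, t ^ 2 * ρ t := fun ε ↦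
      intervalIntegral.integral_symm 1 ε
    simp_rw [heq]
    have h0mem : (0:ℝ) ∈ uIcc (1:ℝ) 0 := right_mem_uIcc
    have hcw := (hc 0 h0mem).neg
    have hle : 𝓝[>] (0:ℝ) ≤ 𝓝[uIcc (1:ℝ) 0] 0 := by
      refine nhdsWithin_le_iff.2 ?_
      rw [uIcc_comm, uIcc_of_le zero_le_one]
      exact mem_of_superset (Ioc_mem_nhdsGT one_pos) Ioc_subset_Icc_self
    exact hcw.tendsto.mono_left hle
  -- the limit of the boundary term `ε² ψ(ε) → 0`
  have hBD : Tendsto (fun ε ↦ ε ^ 2 * ψ ε) (𝓝[>] 0) (𝓝 0) := by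
    have hlim := jacobi_tendsto_trace_shape_sub_div h0 hA hA' hRc hA0 hA'0
    have h1 : Tendsto (fun ε : ℝ ↦ ε ^ 2) (𝓝[>] 0) (𝓝 0) := by
      have : Tendsto (fun ε : ℝ ↦ ε ^ 2) (𝓝 0) (𝓝 (0 ^ 2)) := (continuous_pow 2).tendsto 0
      rw [zero_pow two_ne_zero] at this
      exact this.mono_left nhdsWithin_le_nhds
    have h2 : Tendsto (fun ε : ℝ ↦ m * ε) (𝓝[>] 0) (𝓝 0) := by
      have : Tendsto (fun ε : ℝ ↦ m * ε) (𝓝 0) (𝓝 (m * 0)) :=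
        (continuous_const.mul continuous_id).tendsto 0
      rw [mul_zero] at this
      exact this.mono_left nhdsWithin_le_nhds
    have h3 := (h1.mul hlim).add h2
    rw [zero_mul, zero_add] at h3
    refine h3.congr' ?_
    filter_upwards [self_mem_nhdsWithin] with ε hε
    have hε0 : ε ≠ 0 := (mem_Ioi.1 hε).ne'
    simp only [hψ_def, hm_def]
    field_simp
    ring
  -- conclusion
  have hRHS : Tendsto (fun ε ↦ 2 * m - m * ε + ε ^ 2 * ψ ε) (𝓝[>] 0) (𝓝 (2 * m)) := by
    have h2 : Tendsto (fun ε : ℝ ↦ m * ε) (𝓝[>] 0) (𝓝 0) := by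
      have : Tendsto (fun ε : ℝ ↦ m * ε) (𝓝 0) (𝓝 (m * 0)) :=
        (continuous_const.mul continuous_id).tendsto 0
      rw [mul_zero] at this
      exact this.mono_left nhdsWithin_le_nhds
    have h := ((tendsto_const_nhds (x := 2 * m)).sub h2).add hBD
    rwa [sub_zero, add_zero] at h
  have hev : ∀ᶠ ε in 𝓝[>] (0:ℝ),
      (∫ t in ε..1, t ^ 2 * ρ t) + (∫ t in (1:ℝ)..(L - 1), ρ t) +
        ∫ t in (L - 1)..L, (L - t) ^ 2 * ρ t ≤ 2 * m - m * ε + ε ^ 2 * ψ ε := by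
    filter_upwards [Ioo_mem_nhdsGT one_pos] with ε hε
    exact hsum ε hε
  have hlim := le_of_tendsto_of_tendsto
    ((hLHS.add tendsto_const_nhds).add tendsto_const_nhds) hRHS hev
  simpa [hm_def] using hlim

end MatrixLayer

/-! ### The second variation inequality along a minimizing geodesic; (2.distancebound) -/

section Geodesic

variable {E : Type*} [NormedAddCommGroup E] [NormedSpace ℝ E] [FiniteDimensional ℝ E]
  [CompleteSpace E] {M : Type*} [TopologicalSpace M] [ChartedSpace E M] [IsManifold 𝓘(ℝ, E) ∞ M]
  [T2Space M]
  (g : PseudoRiemannianMetric 𝓘(ℝ, E) ∞ E (TangentSpace 𝓘(ℝ, E) : M → Type _)) [g.HasLeviCivita]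
  [CovariantDerivative.ContMDiffCovariantDerivative g.leviCivita 1]
  [CovariantDerivative.ContMDiffCovariantDerivative g.leviCivita ∞]

/-- **The second variation inequality along a minimizing geodesic, trapezoid test function**
(Haslhofer–Müller 2011, App., proof of Lemma 2.1: "Consider a minimizing geodesic `γ(s)`,
`0 ≤ s ≤ s₀` … By the second variation formula for the energy of `γ`,
`∫₀^{s₀} φ² Rc(γ',γ') ds ≤ (n-1)∫₀^{s₀} φ'² ds = 2n - 2`"), here on `[0, L]` for every
`2 < L < s₀` (so that `L` is not conjugate to `0`): for a smooth Riemannian metric with complete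
Levi-Civita connection, a unit vector `u` at `p` with `γ_u` minimizing up to `s₀`
(`IsMinimizingUpTo`), and `ρ` continuous on `[0, L]` with `ρ(t) = Ric(γ̇_u(t), γ̇_u(t))` on
`(0, s₀)`: `∫₀¹ t²ρ + ∫₁^{L-1} ρ + ∫_{L-1}^L (L-t)²ρ ≤ 2(dim M - 1)`. Proof: a full parallel
orthonormal frame along `γ_u` (`exists_fullFrame_along_maximalGeodesic`), no conjugate points
before `s₀` along a minimizing segment (`mfderiv_riemannianExpMap_injective_of_mem_injectivityDomain`,
Lee 2018, Thm. 10.26), the normal Jacobi tensor in the frame with `tr ℛ = Ric(γ̇, γ̇)`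
(`normalJacobiTensor_frame_hyps`), and `jacobi_index_trapezoid`.
[cite: HaslhoferMuller2011, App., proof of Lemma 2.1 (p. 15)]
[cite: LeeRiemannianManifolds2018, Thm. 10.26] -/
theorem ricci_trapezoid_le_of_isMinimizingUpTo (hg : g.IsRiemannian)
    (hc : IsGeodesicallyComplete g.leviCivita) (p : M) (u : TangentSpace 𝓘(ℝ, E) p)
    (hu : g.val p u u = 1) {s₀ L : ℝ} (hL : 2 < L) (hLs : L < s₀)
    (hmin : IsMinimizingUpTo g hg p u s₀)
    {ρ : ℝ → ℝ} (hρc : ContinuousOn ρ (Icc 0 L))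
    (hρ : ∀ t ∈ Ioo 0 s₀, g.leviCivita.ricci (maximalGeodesic g.leviCivita p u t)
        (velocity 𝓘(ℝ, E) (maximalGeodesic g.leviCivita p u) t)
        (velocity 𝓘(ℝ, E) (maximalGeodesic g.leviCivita p u) t) = ρ t) :
    (∫ t in (0:ℝ)..1, t ^ 2 * ρ t) + (∫ t in (1:ℝ)..(L - 1), ρ t) +
        ∫ t in (L - 1)..L, (L - t) ^ 2 * ρ t ≤ 2 * ((Module.finrank ℝ E : ℝ) - 1) := by
  classical
  have hLC := PseudoRiemannianMetric.isLeviCivita_leviCivita_holds (g := g)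
  have hreg1 : g.leviCivita.IsLocallyContMDiff 1 :=
    hLC.isLocallyContMDiff_one (WithTop.coe_le_coe.mpr le_top)
  have hinf : g.leviCivita.IsLocallyContMDiff (⊤ : ℕ∞) := hLC.isLocallyContMDiff ⊤ (le_of_eq rfl)
  have h2 : (2 : ℕ∞ω) ≤ (∞ : ℕ∞ω) := WithTop.coe_le_coe.2 le_top
  have hs₀ : 0 < s₀ := by linarith
  have h0 : (0 : ℝ) ∈ Ioo (-1) s₀ := ⟨by norm_num, hs₀⟩
  obtain ⟨k', f, hfnone, hfpar, hon, hcard⟩ :=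
    exists_fullFrame_along_maximalGeodesic g hg hc p u hu h0
  -- no conjugate points before `s₀`
  have hinj : ∀ t ∈ Ioo 0 s₀, Injective (mfderiv 𝓘(ℝ, E) 𝓘(ℝ, E)
      (fun w : E ↦ expMap g.leviCivita p (show TangentSpace 𝓘(ℝ, E) p from w))
        (t • (show E from u))) := by
    intro t ht
    have ht0 : t ≠ 0 := ht.1.ne'
    have hID : t • u ∈ injectivityDomain g hg p := by
      refine ⟨s₀ / t, (one_lt_div ht.1).2 ht.2, ?_⟩
      rw [isMinimizingUpTo_smul_iff hg hc p u ht.1, show t * (s₀ / t) = s₀ by field_simp]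
      exact hmin
    exact mfderiv_riemannianExpMap_injective_of_mem_injectivityDomain g le_rfl hg hc p hID
  obtain ⟨J, hJ⟩ := normalJacobiTensor_frame_hyps g hreg1 hinf h2 hc p u h0 f hfnone hfpar hon
    hcard hinj
  obtain ⟨hA, hA', hR, hRc, hA0, hA'0, hdet, htr⟩ := hJ
  have hρ' : ∀ t ∈ Ioo 0 s₀, (Matrix.of fun i j ↦
      g.val (maximalGeodesic g.leviCivita p u t) (g.leviCivita.curvature
        (maximalGeodesic g.leviCivita p u t) (f t (some j))
        (velocity 𝓘(ℝ, E) (maximalGeodesic g.leviCivita p u) t)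
        (velocity 𝓘(ℝ, E) (maximalGeodesic g.leviCivita p u) t)) (f t (some i))).trace = ρ t :=
    fun t ht ↦ (htr t ⟨by linarith [ht.1], ht.2⟩).trans (hρ t ht)
  have key := jacobi_index_trapezoid h0 hA hA' hR hRc hA0 hA'0 hdet hρ' hL hLs hρc
  have hcard' : (Fintype.card (Fin k') : ℝ) = (Module.finrank ℝ E : ℝ) - 1 := by
    rw [← hcard, Fintype.card_option]
    push_cast
    ring
  rw [hcard'] at key
  exact key

/-- `d/dt (t²) = 2t`. [folklore] -/
theorem hasDerivAt_sq' (t : ℝ) : HasDerivAt (fun s : ℝ ↦ s ^ 2) (2 * t) t := by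
  have h := hasDerivAt_pow 2 t
  have h' : HasDerivAt (fun s : ℝ ↦ s ^ 2) ((2:ℕ) * t ^ (2 - 1)) t := h
  convert h' using 1
  push_cast
  ring

/-- `d/dt (L - t)² = -2(L - t)`. [folklore] -/
theorem hasDerivAt_sub_sq' (L t : ℝ) : HasDerivAt (fun s : ℝ ↦ (L - s) ^ 2) (-(2 * (L - t))) t := by
  have h := (hasDerivAt_pow 2 (L - t)).comp t ((hasDerivAt_id t).const_sub L)
  have h' : HasDerivAt (fun s : ℝ ↦ (L - s) ^ 2) ((2:ℕ) * (L - t) ^ (2 - 1) * (-1)) t := h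
  convert h' using 1
  push_cast
  ring

/-- `∫₀¹ t (a + t/2) dt = a/2 + 1/6`. [folklore] -/
theorem integral_id_mul_add (a : ℝ) :
    ∫ t in (0:ℝ)..1, t * (a + t / 2) = a / 2 + 1 / 6 := by
  have e1 : (fun t : ℝ ↦ t * (a + t / 2)) = fun t ↦ a * t + (1 / 2 : ℝ) * t ^ 2 := by
    funext t; ring
  rw [e1, intervalIntegral.integral_add, intervalIntegral.integral_const_mul,
    intervalIntegral.integral_const_mul, integral_id, integral_pow]
  · norm_num
    ring
  · exact (continuous_const.mul continuous_id).intervalIntegrable _ _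
  · exact (continuous_const.mul (continuous_pow 2)).intervalIntegrable _ _

/-- **Haslhofer–Müller 2011, (2.distancebound), along a minimizing unit speed geodesic** (App.,
proof of Lemma 2.1: "Note that by the soliton equation `Rc(γ',γ') = ½ - ∇_{γ'}∇_{γ'} f`, which
implies `d(x,y)/2 + 4/3 - 2n ≤ ∫₀^{s₀} φ² ∇_{γ'}∇_{γ'}f ds = -2∫₀¹ φ ∇_{γ'}f ds
+ 2∫_{s₀-1}^{s₀} φ ∇_{γ'} f ds ≤ sup_{[0,1]}|∇_{γ'}f| + sup_{[s₀-1,s₀]}|∇_{γ'}f|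
≤ √(f(x)+C₁) + ½ + √(f(y)+C₁) + ½`, where we used (2.dfbound) and the fact that `√(f+C₁)` is
`½`-Lipschitz"), here with `C₁ = 0`, on the sub-segment `[0, L]`, `2 < L < s₀`, of `γ_u`
(`u` unit at `p`, `γ_u` minimizing up to `s₀`), for a smooth `f` with `|∇f|² ≤ f` on a gradient
shrinker `Ric + Hess f = g/2`: `L/2 + 2/3 - 2 dim M - √f(p) ≤ √f(γ_u(L))` (the printed constant
`4/3 - 2n - 1` improved by `1/3` through `|∇_{γ'}f|(γ(s)) ≤ √f(γ(0)) + s/2` under the integral).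
Ingredients: `F = f ∘ γ_u` has `F' = df(γ̇)` (`hasDerivAt_comp_curve_mvfderiv`),
`F'' = Hess f(γ̇, γ̇)` (`hasDerivAt_mvfderiv_velocity_of_isGeodesicOn`), so
`Ric(γ̇,γ̇) = ½ - F''` (unit speed); `ricci_trapezoid_le_of_isMinimizingUpTo`; integration by
parts on the three pieces; `|F'| ≤ |∇f| ≤ √f` (Cauchy–Schwarz) and the Lipschitz bound
`ofReal_two_mul_sqrt_sub_sqrt_le_edist` with `d(γ(0), γ(s)) ≤ s`.
[cite: HaslhoferMuller2011, App., proof of Lemma 2.1, (2.distancebound) (p. 15)] -/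
theorem hm_distance_bound (hg : g.IsRiemannian) (hc : IsGeodesicallyComplete g.leviCivita)
    {f : M → ℝ} (hf : ContMDiff 𝓘(ℝ, E) 𝓘(ℝ, ℝ) ∞ f) (hgrad : ∀ x, g.gradSq f x ≤ f x)
    (hsol : ∀ (x : M) (X Y : TangentSpace 𝓘(ℝ, E) x),
      g.ricci x X Y + g.hessian f x X Y = (1 / 2 : ℝ) * g.val x X Y)
    (p : M) (u : TangentSpace 𝓘(ℝ, E) p) (hu : g.val p u u = 1) {s₀ L : ℝ} (hL : 2 < L)
    (hLs : L < s₀) (hmin : IsMinimizingUpTo g hg p u s₀) :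
    L / 2 + 2 / 3 - 2 * (Module.finrank ℝ E : ℝ) - Real.sqrt (f p) ≤
      Real.sqrt (f (maximalGeodesic g.leviCivita p u L)) := by
  have hLC := PseudoRiemannianMetric.isLeviCivita_leviCivita_holds (g := g)
  obtain ⟨-, hgeo, hγ0, hγu⟩ := maximalGeodesic_of_isGeodesicallyComplete hc p u
  have h2 : (2 : ℕ∞ω) ≤ (∞ : ℕ∞ω) := WithTop.coe_le_coe.2 le_top
  have hγ0' : maximalGeodesic g.leviCivita p u 0 = p := hγ0
  -- unit speed
  have hspeed : ∀ t, g.val (maximalGeodesic g.leviCivita p u t)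
      (velocity 𝓘(ℝ, E) (maximalGeodesic g.leviCivita p u) t)
      (velocity 𝓘(ℝ, E) (maximalGeodesic g.leviCivita p u) t) = 1 := by
    intro t
    rw [g.val_velocity_eq_of_isGeodesicOn_of_isCompatible hLC.2 isOpen_univ Set.ordConnected_univ
      hgeo (mem_univ t) (mem_univ 0), hγu, hγ0']
    exact hu
  -- the potential along the geodesic and its first two derivatives
  set F : ℝ → ℝ := fun t ↦ f (maximalGeodesic g.leviCivita p u t) with hF_def
  set F₁ : ℝ → ℝ := fun t ↦ mvfderiv 𝓘(ℝ, E) f (maximalGeodesic g.leviCivita p u t)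
    (velocity 𝓘(ℝ, E) (maximalGeodesic g.leviCivita p u) t) with hF₁_def
  set F₂ : ℝ → ℝ := fun t ↦ g.hessian f (maximalGeodesic g.leviCivita p u t)
    (velocity 𝓘(ℝ, E) (maximalGeodesic g.leviCivita p u) t)
    (velocity 𝓘(ℝ, E) (maximalGeodesic g.leviCivita p u) t) with hF₂_def
  have hγd : ∀ t, MDifferentiableAt 𝓘(ℝ, ℝ) 𝓘(ℝ, E) (maximalGeodesic g.leviCivita p u) t :=
    fun t ↦ mdifferentiableAt_of_mdifferentiableAt_lift (hgeo.1 t (mem_univ t))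
  have hFd : ∀ t, HasDerivAt F (F₁ t) t := fun t ↦
    hasDerivAt_comp_curve_mvfderiv ((hf _).mdifferentiableAt (by simp)) (hγd t)
  have hF₁d : ∀ t, HasDerivAt F₁ (F₂ t) t := fun t ↦
    g.hasDerivAt_mvfderiv_velocity_of_isGeodesicOn hgeo (mem_univ t) ((hf _).of_le h2)
  -- `F` is smooth, hence `F₁ = F'` and `F₂ = F''` are smooth
  have hγs : ContMDiff 𝓘(ℝ, ℝ) 𝓘(ℝ, E) ∞ (maximalGeodesic g.leviCivita p u) :=
    (contMDiff_maximalGeodesic_family hc p).comp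
      (contMDiff_id.prodMk (contMDiff_const (c := (show E from u))))
  have hFs : ContDiff ℝ ∞ F := (hf.comp hγs).contDiff
  have hdF : deriv F = F₁ := funext fun t ↦ (hFd t).deriv
  have hdF₁ : deriv F₁ = F₂ := funext fun t ↦ (hF₁d t).deriv
  have hF₁s : ContDiff ℝ ∞ F₁ := hdF ▸ (contDiff_infty_iff_deriv.mp hFs).2
  have hF₂s : ContDiff ℝ ∞ F₂ := hdF₁ ▸ (contDiff_infty_iff_deriv.mp hF₁s).2
  have hF₁c : Continuous F₁ := hF₁s.continuous
  have hF₂c : Continuous F₂ := hF₂s.continuous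
  -- the Ricci curvature along the geodesic: `Ric(γ', γ') = ½ - F''`
  have hρ : ∀ t ∈ Ioo 0 s₀, g.leviCivita.ricci (maximalGeodesic g.leviCivita p u t)
      (velocity 𝓘(ℝ, E) (maximalGeodesic g.leviCivita p u) t)
      (velocity 𝓘(ℝ, E) (maximalGeodesic g.leviCivita p u) t) = (fun t ↦ 1 / 2 - F₂ t) t := by
    intro t _
    have h := hsol (maximalGeodesic g.leviCivita p u t)
      (velocity 𝓘(ℝ, E) (maximalGeodesic g.leviCivita p u) t)
      (velocity 𝓘(ℝ, E) (maximalGeodesic g.leviCivita p u) t)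
    rw [hspeed t, mul_one] at h
    have h' : g.leviCivita.ricci (maximalGeodesic g.leviCivita p u t)
        (velocity 𝓘(ℝ, E) (maximalGeodesic g.leviCivita p u) t)
        (velocity 𝓘(ℝ, E) (maximalGeodesic g.leviCivita p u) t) + F₂ t = 1 / 2 := h
    linarith
  have hρc : ContinuousOn (fun t ↦ 1 / 2 - F₂ t) (Icc 0 L) :=
    (continuous_const.sub hF₂c).continuousOn
  have key := ricci_trapezoid_le_of_isMinimizingUpTo g hg hc p u hu hL hLs hmin hρc hρ
  -- integrability
  have hi1 : ∀ a b : ℝ, IntervalIntegrable F₁ volume a b := fun a b ↦ hF₁c.intervalIntegrable a b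
  have hi2 : ∀ a b : ℝ, IntervalIntegrable F₂ volume a b := fun a b ↦ hF₂c.intervalIntegrable a b
  -- piece 1: `∫₀¹ t² (½ - F'') = 1/6 - F'(1) + 2 ∫₀¹ t F'`
  have hI1 : ∫ t in (0:ℝ)..1, t ^ 2 * (1 / 2 - F₂ t) =
      1 / 6 - F₁ 1 + 2 * ∫ t in (0:ℝ)..1, t * F₁ t := by
    have hparts := intervalIntegral.integral_mul_deriv_eq_deriv_mul (a := (0:ℝ)) (b := 1)
      (u := fun t ↦ t ^ 2) (u' := fun t ↦ 2 * t) (v := F₁) (v' := F₂)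
      (fun t _ ↦ hasDerivAt_sq' t) (fun t _ ↦ hF₁d t)
      ((continuous_const.mul continuous_id).intervalIntegrable 0 1) (hi2 0 1)
    have hsplit : ∫ t in (0:ℝ)..1, t ^ 2 * (1 / 2 - F₂ t) =
        (∫ t in (0:ℝ)..1, t ^ 2 * (1 / 2 : ℝ)) - ∫ t in (0:ℝ)..1, t ^ 2 * F₂ t := by
      rw [← intervalIntegral.integral_sub]
      · congr 1
        funext t
        ring
      · exact ((continuous_pow 2).mul continuous_const).intervalIntegrable 0 1
      · exact ((continuous_pow 2).mul hF₂c).intervalIntegrable 0 1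
    have hc1 : ∫ t in (0:ℝ)..1, t ^ 2 * (1 / 2 : ℝ) = 1 / 6 := by
      rw [intervalIntegral.integral_mul_const, integral_pow]
      norm_num
    have hc2 : ∫ t in (0:ℝ)..1, 2 * t * F₁ t = 2 * ∫ t in (0:ℝ)..1, t * F₁ t := by
      rw [← intervalIntegral.integral_const_mul]
      congr 1
      funext t
      ring
    rw [hsplit, hc1, hparts, hc2]
    ring
  -- piece 2: `∫₁^{L-1} (½ - F'') = (L-2)/2 - F'(L-1) + F'(1)`
  have hI2 : ∫ t in (1:ℝ)..(L - 1), (1 / 2 - F₂ t) = (L - 2) / 2 - (F₁ (L - 1) - F₁ 1) := by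
    rw [intervalIntegral.integral_sub (_root_.continuous_const.intervalIntegrable _ _) (hi2 _ _),
      intervalIntegral.integral_const,
      intervalIntegral.integral_eq_sub_of_hasDerivAt (fun t _ ↦ hF₁d t) (hi2 _ _)]
    simp only [smul_eq_mul]
    ring
  -- piece 3: `∫_{L-1}^L (L-t)² (½ - F'') = 1/6 + F'(L-1) - 2 ∫ (L-t) F'`
  have hI3 : ∫ t in (L - 1)..L, (L - t) ^ 2 * (1 / 2 - F₂ t) =
      1 / 6 + F₁ (L - 1) - 2 * ∫ t in (L - 1)..L, (L - t) * F₁ t := by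
    have hparts := intervalIntegral.integral_mul_deriv_eq_deriv_mul (a := L - 1) (b := L)
      (u := fun t ↦ (L - t) ^ 2) (u' := fun t ↦ -(2 * (L - t))) (v := F₁) (v' := F₂)
      (fun t _ ↦ hasDerivAt_sub_sq' L t) (fun t _ ↦ hF₁d t)
      (((continuous_const.sub continuous_id).const_mul (2:ℝ)).neg.intervalIntegrable _ _)
      (hi2 _ _)
    have hsplit : ∫ t in (L - 1)..L, (L - t) ^ 2 * (1 / 2 - F₂ t) =
        (∫ t in (L - 1)..L, (L - t) ^ 2 * (1 / 2 : ℝ)) - ∫ t in (L - 1)..L, (L - t) ^ 2 * F₂ t := by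
      rw [← intervalIntegral.integral_sub]
      · congr 1
        funext t
        ring
      · exact (((continuous_const.sub continuous_id).pow 2).mul continuous_const).intervalIntegrable
          _ _
      · exact (((continuous_const.sub continuous_id).pow 2).mul hF₂c).intervalIntegrable _ _
    have hc1 : ∫ t in (L - 1)..L, (L - t) ^ 2 * (1 / 2 : ℝ) = 1 / 6 := by
      have h := intervalIntegral.integral_comp_sub_left (fun x : ℝ ↦ x ^ 2 * (1 / 2 : ℝ)) L
        (a := L - 1) (b := L)
      simp only [sub_sub_cancel, sub_self] at h
      rw [h, intervalIntegral.integral_mul_const, integral_pow]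
      norm_num
    have hc2 : ∫ t in (L - 1)..L, -(2 * (L - t)) * F₁ t = -(2 * ∫ t in (L - 1)..L, (L - t) * F₁ t) := by
      rw [← intervalIntegral.integral_const_mul, ← intervalIntegral.integral_neg]
      congr 1
      funext t
      ring
    rw [hsplit, hc1, hparts, hc2]
    simp only [sub_self, sub_sub_cancel]
    ring
  -- pointwise bounds on `F'`: `|F'| ≤ |∇f| ≤ √f`, and the Lipschitz bound along the geodesic
  have hF₁abs : ∀ t, |F₁ t| ≤ Real.sqrt (f (maximalGeodesic g.leviCivita p u t)) := by
    intro t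
    have h := abs_mvfderiv_le_sqrt_gradSq_mul_sqrt g hg f (maximalGeodesic g.leviCivita p u t)
      (velocity 𝓘(ℝ, E) (maximalGeodesic g.leviCivita p u) t)
    rw [hspeed t, Real.sqrt_one, mul_one] at h
    exact h.trans (Real.sqrt_le_sqrt (hgrad _))
  have hf1 : ContMDiff 𝓘(ℝ, E) 𝓘(ℝ, ℝ) 1 f := hf.of_le (by norm_cast)
  have hLip0 : ∀ t, 0 ≤ t → Real.sqrt (f (maximalGeodesic g.leviCivita p u t)) ≤
      Real.sqrt (f p) + t / 2 := by
    intro t ht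
    have h1 := ofReal_two_mul_sqrt_sub_sqrt_le_edist g hg hf1 hgrad p
      (maximalGeodesic g.leviCivita p u t)
    have h2 : g.edist hg p (maximalGeodesic g.leviCivita p u t) ≤ ENNReal.ofReal t := by
      have h := edist_maximalGeodesic_le_length hg hc p u (a := 0) (b := t) ht
      rw [length_maximalGeodesic hg hc p u 0 t, hu, Real.sqrt_one, mul_one, sub_zero, hγ0'] at h
      exact h
    have h3 := (ENNReal.ofReal_le_ofReal_iff ht).1 (h1.trans h2)
    linarith
  have hLipL : ∀ t, t ≤ L → Real.sqrt (f (maximalGeodesic g.leviCivita p u t)) ≤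
      Real.sqrt (f (maximalGeodesic g.leviCivita p u L)) + (L - t) / 2 := by
    intro t ht
    have h1 := ofReal_two_mul_sqrt_sub_sqrt_le_edist g hg hf1 hgrad
      (maximalGeodesic g.leviCivita p u L) (maximalGeodesic g.leviCivita p u t)
    have h2 : g.edist hg (maximalGeodesic g.leviCivita p u L) (maximalGeodesic g.leviCivita p u t) ≤
        ENNReal.ofReal (L - t) := by
      have h := edist_maximalGeodesic_le_length hg hc p u (a := t) (b := L) ht
      rw [length_maximalGeodesic hg hc p u t L, hu, Real.sqrt_one, mul_one] at h
      rw [PseudoRiemannianMetric.edist_comm]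
      exact h
    have h3 := (ENNReal.ofReal_le_ofReal_iff (by linarith)).1 (h1.trans h2)
    linarith
  -- the two integral bounds
  have hB1 : -(Real.sqrt (f p) + 1 / 3) ≤ 2 * ∫ t in (0:ℝ)..1, t * F₁ t := by
    have hmono : ∫ t in (0:ℝ)..1, -(t * (Real.sqrt (f p) + t / 2)) ≤ ∫ t in (0:ℝ)..1, t * F₁ t := by
      refine intervalIntegral.integral_mono_on zero_le_one ?_ ?_ fun t ht ↦ ?_
      · exact ((continuous_id.mul (continuous_const.add (continuous_id.div_const _))).neg
          ).intervalIntegrable _ _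
      · exact (continuous_id.mul hF₁c).intervalIntegrable _ _
      · have h1 := hLip0 t ht.1
        have h2 : -Real.sqrt (f (maximalGeodesic g.leviCivita p u t)) ≤ F₁ t :=
          (abs_le.1 (hF₁abs t)).1
        have h3 : -(Real.sqrt (f p) + t / 2) ≤ F₁ t := by linarith
        have := mul_le_mul_of_nonneg_left h3 ht.1
        linarith
    have hval : ∫ t in (0:ℝ)..1, -(t * (Real.sqrt (f p) + t / 2)) = -(Real.sqrt (f p) / 2 + 1 / 6) := by
      rw [intervalIntegral.integral_neg, integral_id_mul_add]
    linarith
  have hB2 : 2 * ∫ t in (L - 1)..L, (L - t) * F₁ t ≤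
      Real.sqrt (f (maximalGeodesic g.leviCivita p u L)) + 1 / 3 := by
    have hmono : ∫ t in (L - 1)..L, (L - t) * F₁ t ≤ ∫ t in (L - 1)..L,
        (L - t) * (Real.sqrt (f (maximalGeodesic g.leviCivita p u L)) + (L - t) / 2) := by
      refine intervalIntegral.integral_mono_on (by linarith) ?_ ?_ fun t ht ↦ ?_
      · exact ((continuous_const.sub continuous_id).mul hF₁c).intervalIntegrable _ _
      · exact ((continuous_const.sub continuous_id).mul
          (continuous_const.add ((continuous_const.sub continuous_id).div_const _))).intervalIntegrable _ _
      · have h1 := hLipL t ht.2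
        have h2 : F₁ t ≤ Real.sqrt (f (maximalGeodesic g.leviCivita p u t)) :=
          (abs_le.1 (hF₁abs t)).2
        have h3 : F₁ t ≤ Real.sqrt (f (maximalGeodesic g.leviCivita p u L)) + (L - t) / 2 := by
          linarith
        exact mul_le_mul_of_nonneg_left h3 (by linarith [ht.2])
    have hval : ∫ t in (L - 1)..L,
        (L - t) * (Real.sqrt (f (maximalGeodesic g.leviCivita p u L)) + (L - t) / 2) =
        Real.sqrt (f (maximalGeodesic g.leviCivita p u L)) / 2 + 1 / 6 := by
      have h := intervalIntegral.integral_comp_sub_left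
        (fun x : ℝ ↦ x * (Real.sqrt (f (maximalGeodesic g.leviCivita p u L)) + x / 2)) L
        (a := L - 1) (b := L)
      simp only [sub_sub_cancel, sub_self] at h
      rw [h, integral_id_mul_add]
    linarith
  -- conclusion
  rw [hI1, hI2, hI3] at key
  linarith


/-- **(2.distancebound) at the endpoint of the minimizing segment**: the limit `L → s₀⁻` of
`hm_distance_bound` (continuity of `f ∘ γ_u`): `s₀/2 + 2/3 - 2 dim M - √f(p) ≤ √f(γ_u(s₀))` for
`γ_u` minimizing up to `s₀ > 2`. [cite: HaslhoferMuller2011, App., proof of Lemma 2.1, (2.distancebound) (p. 15)] -/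
theorem hm_distance_bound_endpoint (hg : g.IsRiemannian) (hc : IsGeodesicallyComplete g.leviCivita)
    {f : M → ℝ} (hf : ContMDiff 𝓘(ℝ, E) 𝓘(ℝ, ℝ) ∞ f) (hgrad : ∀ x, g.gradSq f x ≤ f x)
    (hsol : ∀ (x : M) (X Y : TangentSpace 𝓘(ℝ, E) x),
      g.ricci x X Y + g.hessian f x X Y = (1 / 2 : ℝ) * g.val x X Y)
    (p : M) (u : TangentSpace 𝓘(ℝ, E) p) (hu : g.val p u u = 1) {s₀ : ℝ} (hs₀ : 2 < s₀)
    (hmin : IsMinimizingUpTo g hg p u s₀) :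
    s₀ / 2 + 2 / 3 - 2 * (Module.finrank ℝ E : ℝ) - Real.sqrt (f p) ≤
      Real.sqrt (f (maximalGeodesic g.leviCivita p u s₀)) := by
  set G : ℝ → ℝ := fun L ↦ Real.sqrt (f (maximalGeodesic g.leviCivita p u L)) - L / 2 with hG_def
  have hγs : ContMDiff 𝓘(ℝ, ℝ) 𝓘(ℝ, E) ∞ (maximalGeodesic g.leviCivita p u) :=
    (contMDiff_maximalGeodesic_family hc p).comp
      (contMDiff_id.prodMk (contMDiff_const (c := (show E from u))))
  have hGc : Continuous G :=
    ((hf.comp hγs).continuous.sqrt).sub (continuous_id.div_const _)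
  have hev : ∀ᶠ L in 𝓝[<] s₀, 2 / 3 - 2 * (Module.finrank ℝ E : ℝ) - Real.sqrt (f p) ≤ G L := by
    filter_upwards [Ioo_mem_nhdsLT hs₀] with L hL
    have h := hm_distance_bound g hg hc hf hgrad hsol p u hu hL.1 hL.2 hmin
    simp only [hG_def]
    linarith
  have hlim : Tendsto G (𝓝[<] s₀) (𝓝 (G s₀)) :=
    (hGc.tendsto s₀).mono_left nhdsWithin_le_nhds
  have h := ge_of_tendsto hlim hev
  simp only [hG_def] at h
  linarith

/-- **Haslhofer–Müller 2011, (2.distancebound), for two points** ("for all `x, y ∈ M`", with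
`C₁ = 0`): on a connected manifold with a smooth Riemannian metric whose closed distance balls are
compact (so that the Levi-Civita connection is complete, Hopf–Rinow,
`isGeodesicallyComplete_iff_isCompact_setOf_edist_le`, and any two points are joined by a
minimizing segment, `exists_isMinimizingUpTo_of_isGeodesicallyComplete`), a smooth `f` with
`|∇f|² ≤ f` and `Ric + Hess f = g/2`: if `d(y, x) > 2` then
`d(y,x)/2 + 2/3 - 2 dim M - √f(y) ≤ √f(x)` (`hm_distance_bound_endpoint` on the unit speed
reparametrisation of the segment). [cite: HaslhoferMuller2011, App., proof of Lemma 2.1, (2.distancebound) (p. 15)] -/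
theorem hm_distance_bound_of_edist [ConnectedSpace M] (hg : g.IsRiemannian)
    (hcpt : ∀ (x : M) (r : ℝ≥0), IsCompact {y : M | g.edist hg x y ≤ r})
    {f : M → ℝ} (hf : ContMDiff 𝓘(ℝ, E) 𝓘(ℝ, ℝ) ∞ f) (hgrad : ∀ x, g.gradSq f x ≤ f x)
    (hsol : ∀ (x : M) (X Y : TangentSpace 𝓘(ℝ, E) x),
      g.ricci x X Y + g.hessian f x X Y = (1 / 2 : ℝ) * g.val x X Y)
    (y x : M) (hd : 2 < (g.edist hg y x).toReal) :
    (g.edist hg y x).toReal / 2 + 2 / 3 - 2 * (Module.finrank ℝ E : ℝ) - Real.sqrt (f y) ≤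
      Real.sqrt (f x) := by
  have hc : IsGeodesicallyComplete g.leviCivita :=
    (isGeodesicallyComplete_iff_isCompact_setOf_edist_le g le_rfl hg).2 hcpt
  obtain ⟨v, hmin, hq⟩ := exists_isMinimizingUpTo_of_isGeodesicallyComplete g le_rfl hg hc y x
  have h1 : x = maximalGeodesic g.leviCivita y v 1 := by
    rw [← hq]
    exact expMap_eq_maximalGeodesic hc y v
  have hdist : g.edist hg y x = ENNReal.ofReal (Real.sqrt (g.val y v v)) := by
    rw [h1, ← hmin.2, length_maximalGeodesic hg hc y v 0 1, sub_zero, one_mul]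
  set ℓ := Real.sqrt (g.val y v v) with hℓ
  have hℓ0 : 0 ≤ ℓ := Real.sqrt_nonneg _
  have hdℓ : (g.edist hg y x).toReal = ℓ := by rw [hdist, ENNReal.toReal_ofReal hℓ0]
  rw [hdℓ] at hd ⊢
  have hℓpos : 0 < ℓ := by linarith
  -- the unit-speed reparametrisation `u = ℓ⁻¹ v`, minimizing up to `ℓ`
  have hvv0 : 0 ≤ g.val y v v := by
    by_cases hv : v = 0
    · simp [hv]
    · exact (hg y v hv).le
  have hvv : g.val y v v = ℓ ^ 2 := (Real.sq_sqrt hvv0).symm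
  set u : TangentSpace 𝓘(ℝ, E) y := ℓ⁻¹ • v with hu'
  have hu : g.val y u u = 1 := by
    have h2 : g.val y u u = ℓ⁻¹ * ℓ⁻¹ * g.val y v v := by
      rw [hu']
      simp only [map_smul, FunLike.coe_smul, Pi.smul_apply, smul_eq_mul]
      ring
    rw [h2, hvv]
    field_simp
  have hmin' : IsMinimizingUpTo g hg y u ℓ := by
    rw [hu', isMinimizingUpTo_smul_iff hg hc y v (inv_pos.2 hℓpos), inv_mul_cancel₀ hℓpos.ne']
    exact hmin
  have hend : maximalGeodesic g.leviCivita y u ℓ = x := by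
    rw [hu', maximalGeodesic_smul hc y v ℓ⁻¹ ℓ, inv_mul_cancel₀ hℓpos.ne', ← h1]
  have h := hm_distance_bound_endpoint g hg hc hf hgrad hsol y u hu hd hmin'
  rwa [hend] at h

omit [CompleteSpace E] [IsManifold 𝓘(ℝ, E) ∞ M] in
/-- **A connected manifold modelled on a zero-dimensional space is a point** (every chart source
is a singleton, hence open, and a nonempty clopen subset of a connected space is everything).
[folklore] -/
theorem subsingleton_of_finrank_eq_zero [ConnectedSpace M] (h0 : Module.finrank ℝ E = 0) :
    Subsingleton M := by
  haveI : Subsingleton E := Module.finrank_zero_iff.1 h0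
  -- every point is open
  have hopen : ∀ x : M, IsOpen ({x} : Set M) := by
    intro x
    have hsrc : (chartAt E x).source = {x} := by
      refine Subset.antisymm (fun y hy ↦ ?_) (singleton_subset_iff.2 (mem_chart_source E x))
      have : (chartAt E x) y = (chartAt E x) x := Subsingleton.elim _ _
      exact (chartAt E x).injOn hy (mem_chart_source E x) this
    rw [← hsrc]
    exact (chartAt E x).open_source
  constructor
  intro a b
  have hclopen : IsClopen ({a} : Set M) := ⟨isClosed_singleton, hopen a⟩
  have huniv := hclopen.eq_univ (singleton_nonempty a)
  have hb : b ∈ ({a} : Set M) := by rw [huniv]; exact mem_univ b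
  exact (mem_singleton_iff.1 hb).symm

/-- **Existence of a minimum point of the potential** (Haslhofer–Müller 2011, Lemma 2.1: "there
exists a point `p ∈ M` where `f` attains its infimum"; App., proof: "By (2.distancebound), every
minimizing sequence is bounded and `f` attains its infimum at a point `p`"), for a connected
complete (closed balls compact) gradient shrinker with smooth potential, `|∇f|² ≤ f`: the
sub-level set `{f ≤ f(y₀)}` lies in a closed ball about `y₀` (`hm_distance_bound_of_edist`), is
closed, hence compact, so `f` attains its minimum on it, which is a global minimum.
[cite: HaslhoferMuller2011, Lemma 2.1 (p. 5) and App., proof of Lemma 2.1 (p. 15)] -/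
theorem exists_forall_potential_le [ConnectedSpace M] (hg : g.IsRiemannian)
    (hcpt : ∀ (x : M) (r : ℝ≥0), IsCompact {y : M | g.edist hg x y ≤ r})
    {f : M → ℝ} (hf : ContMDiff 𝓘(ℝ, E) 𝓘(ℝ, ℝ) ∞ f) (hgrad : ∀ x, g.gradSq f x ≤ f x)
    (hsol : ∀ (x : M) (X Y : TangentSpace 𝓘(ℝ, E) x),
      g.ricci x X Y + g.hessian f x X Y = (1 / 2 : ℝ) * g.val x X Y) :
    ∃ p : M, ∀ x : M, f p ≤ f x := by
  obtain ⟨y₀⟩ : Nonempty M := inferInstance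
  have hf0 : ∀ x, 0 ≤ f x := fun x ↦ (g.gradSq_nonneg hg f x).trans (hgrad x)
  set B : ℝ := 2 * (2 * Real.sqrt (f y₀) + 2 * (Module.finrank ℝ E : ℝ)) + 2 with hB
  have hB0 : 0 ≤ B := by positivity
  have hB2 : 2 ≤ B := by
    have : 0 ≤ Real.sqrt (f y₀) := Real.sqrt_nonneg _
    have : (0 : ℝ) ≤ (Module.finrank ℝ E : ℝ) := Nat.cast_nonneg _
    linarith
  set S : Set M := {x | f x ≤ f y₀} with hS
  set K : Set M := {x | g.edist hg y₀ x ≤ B.toNNReal} with hK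
  have hsub : S ⊆ K := by
    intro x hx
    by_contra hxK
    simp only [hK, mem_setOf_eq, not_le] at hxK
    have hne : g.edist hg y₀ x ≠ ⊤ := PseudoRiemannianMetric.edist_ne_top hg y₀ x
    have hxK' : ENNReal.ofReal B < g.edist hg y₀ x := hxK
    have hd : B < (g.edist hg y₀ x).toReal := (ENNReal.ofReal_lt_iff_lt_toReal hB0 hne).1 hxK'
    have hsq0 : 0 ≤ Real.sqrt (f y₀) := Real.sqrt_nonneg _
    have hn0 : (0 : ℝ) ≤ (Module.finrank ℝ E : ℝ) := Nat.cast_nonneg _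
    have hd2 : 2 < (g.edist hg y₀ x).toReal := by linarith
    have h := hm_distance_bound_of_edist g hg hcpt hf hgrad hsol y₀ x hd2
    have hsq : Real.sqrt (f x) ≤ Real.sqrt (f y₀) := Real.sqrt_le_sqrt hx
    linarith
  have hSc : IsClosed S := isClosed_le hf.continuous continuous_const
  have hScpt : IsCompact S := (hcpt y₀ _).of_isClosed_subset hSc hsub
  obtain ⟨p, hpS, hpmin⟩ := hScpt.exists_isMinOn ⟨y₀, show f y₀ ≤ f y₀ from le_rfl⟩
    hf.continuous.continuousOn
  refine ⟨p, fun x ↦ ?_⟩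
  by_cases hx : x ∈ S
  · exact hpmin hx
  · simp only [hS, mem_setOf_eq, not_le] at hx
    exact (show f p ≤ f y₀ from hpS).trans hx.le

/-- **Haslhofer–Müller 2011, Lemma 2.1, lower half, given (2.6)** ("`¼(d(x,p) - 5n)₊² ≤ f(x) + C₁`",
with `C₁ = 0`; App., proof: "the quadratic growth estimate follows from (2.lipschitz),
(2.distancebound) and (2.fcest) by setting `y = p`"): for a connected complete (closed balls
compact) gradient shrinker `Ric + Hess f = g/2` with smooth potential normalised by
`R + |∇f|² = f` and with `R ≥ 0`, at every minimum point `p` of `f`: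
`r ≤ d(p, x) ⇒ ¼ (r - 5 dim M)₊² ≤ f(x)` — the lower clause of conjunct (b) of
`shrinkerPotentialGrowth`. For `r ≤ 5n` this is `f ≥ 0`; otherwise `d(p,x) ≥ r > 5n ≥ 5 > 2`
(a `0`-dimensional connected manifold being a point), and `hm_distance_bound_of_edist` with
`√f(p) ≤ √(n/2) ≤ n/2 + 2/3` ((2.fcest), `potential_le_half_dim_of_isLocalMin`) gives
`√f(x) ≥ (d(p,x) - 5n)/2`. [cite: HaslhoferMuller2011, Lemma 2.1 (p. 5) and App., proof of Lemma 2.1 (p. 15)] -/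
theorem potential_lower_of_scalarCurvature_nonneg [ConnectedSpace M] (hg : g.IsRiemannian)
    (hcpt : ∀ (x : M) (r : ℝ≥0), IsCompact {y : M | g.edist hg x y ≤ r})
    {f : M → ℝ} (hf : ContMDiff 𝓘(ℝ, E) 𝓘(ℝ, ℝ) ∞ f)
    (hsol : ∀ (x : M) (X Y : TangentSpace 𝓘(ℝ, E) x),
      g.ricci x X Y + g.hessian f x X Y = (1 / 2 : ℝ) * g.val x X Y)
    (hnorm : ∀ x : M, g.scalarCurvature x + g.gradSq f x = f x)
    (hR : ∀ x : M, 0 ≤ g.scalarCurvature x)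
    {p : M} (hp : ∀ x : M, f p ≤ f x) (x : M) (r : ℝ≥0) (hr : (r : ℝ≥0∞) ≤ g.edist hg p x) :
    (1 / 4 : ℝ) * (max ((r : ℝ) - 5 * (Module.finrank ℝ E : ℝ)) 0) ^ 2 ≤ f x := by
  have hgrad : ∀ x, g.gradSq f x ≤ f x := fun x ↦ by linarith [hR x, hnorm x]
  have hf0 : ∀ x, 0 ≤ f x := fun x ↦ (g.gradSq_nonneg hg f x).trans (hgrad x)
  set n : ℝ := (Module.finrank ℝ E : ℝ) with hn
  have hn0 : 0 ≤ n := by positivity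
  by_cases hr5 : (r : ℝ) ≤ 5 * n
  · rw [max_eq_right (by linarith)]
    calc (1 / 4 : ℝ) * (0 : ℝ) ^ 2 = 0 := by norm_num
      _ ≤ f x := hf0 x
  push Not at hr5
  rw [max_eq_left (by linarith)]
  -- the distance is finite and at least `r > 5n`
  have hne : g.edist hg p x ≠ ⊤ := PseudoRiemannianMetric.edist_ne_top hg p x
  have hrd : (r : ℝ) ≤ (g.edist hg p x).toReal := by
    have := ENNReal.toReal_mono hne hr
    simpa using this
  -- the dimension is positive (a `0`-dimensional connected manifold is a point)
  have hn1 : 1 ≤ n := by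
    by_contra hlt
    push Not at hlt
    have h0 : Module.finrank ℝ E = 0 := by
      have : (Module.finrank ℝ E : ℝ) < 1 := hlt
      exact_mod_cast Nat.lt_one_iff.1 (by exact_mod_cast this)
    haveI := subsingleton_of_finrank_eq_zero (M := M) h0
    have hpx : g.edist hg p x = 0 := by
      rw [Subsingleton.elim x p, PseudoRiemannianMetric.edist_self]
    rw [hpx, ENNReal.toReal_zero] at hrd
    have : (0 : ℝ) ≤ r := r.coe_nonneg
    linarith
  have hd2 : 2 < (g.edist hg p x).toReal := by linarith
  have h := hm_distance_bound_of_edist g hg hcpt hf hgrad hsol p x hd2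
  -- `f(p) ≤ n/2`, so `√f(p) ≤ √(n/2)` and `2/3 - 2n - √f(p) ≥ -5n/2`
  have hmin : IsLocalMin f p := Filter.Eventually.of_forall fun y ↦ hp y
  haveI : CompleteSpace E := inferInstance
  have hfp : f p ≤ n / 2 :=
    potential_le_half_dim_of_isLocalMin g hg (hf.of_le (by norm_cast)) hsol hnorm hmin
  have hsfp : Real.sqrt (f p) ≤ Real.sqrt (n / 2) := Real.sqrt_le_sqrt hfp
  have hkey : Real.sqrt (n / 2) ≤ n / 2 + 2 / 3 := by
    nlinarith [Real.sq_sqrt (show (0:ℝ) ≤ n / 2 by positivity), Real.sqrt_nonneg (n / 2),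
      sq_nonneg (Real.sqrt (n / 2) - 1 / 2)]
  have hlow : ((r : ℝ) - 5 * n) / 2 ≤ Real.sqrt (f x) := by linarith
  have hpos : 0 ≤ ((r : ℝ) - 5 * n) / 2 := by linarith
  calc (1 / 4 : ℝ) * ((r : ℝ) - 5 * n) ^ 2 = (((r : ℝ) - 5 * n) / 2) ^ 2 := by ring
    _ ≤ Real.sqrt (f x) ^ 2 := pow_le_pow_left₀ hpos hlow 2
    _ = f x := Real.sq_sqrt (hf0 x)


end Geodesic

/-! ### Assembly: `shrinkerPotentialGrowth` from (2.6) and Lemma 2.2 alone -/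

section AssemblyTwo

/-- **Reduction of the named fact to (2.6) and Lemma 2.2.** `shrinkerPotentialGrowth`
(Haslhofer–Müller 2011, §2: (2.6), Lemma 2.1, Lemma 2.2, `C₁ = 0`) follows from
(A) (2.6) `R ≥ 0` on every complete connected normalised gradient shrinker [Zha09] and
(V) Lemma 2.2, `Vol B_r(p) ≤ C₂(n) rⁿ` about every minimum point `p` — Lemma 2.1 being now
PROVED given (2.6) for the shrinker at hand (`exists_forall_potential_le`,
`potential_lower_of_scalarCurvature_nonneg`, `potential_le_of_scalarCurvature_nonneg`). The two
inputs enter as hypotheses over exactly the data of the fact; this is NOT a discharge. The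
regularity instances of the smooth Levi-Civita connection are supplied by
`isLocallyContMDiff_leviCivita_holds`. [cite: HaslhoferMuller2011, §2 (2.6), Lemma 2.1, Lemma 2.2 (p. 5); App. (p. 15)] -/
theorem shrinkerPotentialGrowth_of_nonneg_of_volume
    (hA : ∀ (n : ℕ) (M : Type) [TopologicalSpace M] [T2Space M] [SecondCountableTopology M]
      [ChartedSpace (EuclideanSpace ℝ (Fin n)) M] [IsManifold (𝓡 n) ∞ M] [ConnectedSpace M]
      [T3Space M] [MeasurableSpace M] [BorelSpace M]
      (g : PseudoRiemannianMetric (𝓡 n) ∞ (EuclideanSpace ℝ (Fin n)) (TangentSpace (𝓡 n) : M → Type _))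
      [g.HasLeviCivita] (f : M → ℝ) (hg : g.IsRiemannian),
      (∀ (x : M) (r : NNReal), IsCompact {y : M | g.edist hg x y ≤ r}) →
      ContMDiff (𝓡 n) 𝓘(ℝ, ℝ) ∞ f →
      (∀ (x : M) (X Y : TangentSpace (𝓡 n) x),
        g.ricci x X Y + g.hessian f x X Y = (1 / 2 : ℝ) * g.val x X Y) →
      (∀ x : M, g.scalarCurvature x + g.gradSq f x = f x) →
      ∀ x : M, 0 ≤ g.scalarCurvature x)
    (hV : ∀ n : ℕ, ∃ C₂ : ℝ, ∀ (M : Type) [TopologicalSpace M] [T2Space M]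
      [SecondCountableTopology M] [ChartedSpace (EuclideanSpace ℝ (Fin n)) M]
      [IsManifold (𝓡 n) ∞ M] [ConnectedSpace M] [T3Space M] [MeasurableSpace M] [BorelSpace M]
      (g : PseudoRiemannianMetric (𝓡 n) ∞ (EuclideanSpace ℝ (Fin n)) (TangentSpace (𝓡 n) : M → Type _))
      [g.HasLeviCivita] (f : M → ℝ) (hg : g.IsRiemannian),
      (∀ (x : M) (r : NNReal), IsCompact {y : M | g.edist hg x y ≤ r}) →
      ContMDiff (𝓡 n) 𝓘(ℝ, ℝ) ∞ f →
      (∀ (x : M) (X Y : TangentSpace (𝓡 n) x),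
        g.ricci x X Y + g.hessian f x X Y = (1 / 2 : ℝ) * g.val x X Y) →
      (∀ x : M, g.scalarCurvature x + g.gradSq f x = f x) →
      ∀ p : M, (∀ x : M, f p ≤ f x) →
        ∀ r : NNReal, riemannianMeasure (g.toContMDiffRiemannianMetric hg)
          {x : M | g.edist hg p x < r} ≤ ENNReal.ofReal (C₂ * (r : ℝ) ^ n)) :
    shrinkerPotentialGrowth := by
  refine shrinkerPotentialGrowth_of_nonneg_of_lower_of_volume hA ?_ hV
  intro n M _ _ _ _ _ _ _ _ _ g _ f hg hcpt hf hsol hnorm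
  have hk1 : ((1 : ℕ∞) : ℕ∞ω) + 1 ≤ (∞ : ℕ∞ω) := by
    rw [show ((1 : ℕ∞) : ℕ∞ω) + 1 = 2 by norm_num]
    exact WithTop.coe_le_coe.2 le_top
  haveI : CovariantDerivative.ContMDiffCovariantDerivative g.leviCivita 1 :=
    ⟨g.isLocallyContMDiff_leviCivita_holds 1 hk1 univ isOpen_univ⟩
  haveI : CovariantDerivative.ContMDiffCovariantDerivative g.leviCivita ∞ :=
    ⟨g.isLocallyContMDiff_leviCivita_holds ⊤ (le_of_eq rfl) univ isOpen_univ⟩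
  have hR := hA n M g f hg hcpt hf hsol hnorm
  have hgrad : ∀ x, g.gradSq f x ≤ f x := fun x ↦ by linarith [hR x, hnorm x]
  obtain ⟨p, hp⟩ := exists_forall_potential_le g hg hcpt hf hgrad hsol
  refine ⟨p, hp, fun x r hr ↦ ?_⟩
  have h := potential_lower_of_scalarCurvature_nonneg g hg hcpt hf hsol hnorm hR hp x r hr
  rwa [finrank_euclideanSpace_fin] at h

end AssemblyTwo

/-! ### Haslhofer–Müller (2.3)–(2.5), (2.7) in coordinates -/

section CoordIdentities

open Lorentzian.MetricCoord

variable {E : Type*} [NormedAddCommGroup E] [NormedSpace ℝ E] [FiniteDimensional ℝ E]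
  [CompleteSpace E] {G : E → E →L[ℝ] E →L[ℝ] ℝ} {V : Set E} {x : E} {F : E → ℝ}

omit [CompleteSpace E] in
/-- **Haslhofer–Müller (2.3), traced**: for metric components `G` and a potential `F` with
`Ric(G) + Hess_G F = ½ G` near `x`, `S + ΔF = n/2` (`tr_G G = n`).
[cite: HaslhoferMuller2011, §2 (2.3) (p. 5)] -/
theorem scalAt_add_lapAt_of_soliton (hG : IsMetricOn G V) (hx : x ∈ V)
    (hsol : ∀ y ∈ V, ∀ Y Z : E, ricAt G y Y Z + hessAt G F y Y Z = (1 / 2 : ℝ) * G y Y Z) :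
    scalAt G x + lapAt G F x = (finrank ℝ E : ℝ) / 2 := by
  have hi := hG.isInvertible x hx
  have heq : ricAt G x + hessAt G F x = (1 / 2 : ℝ) • G x := by
    ext Y Z
    simp only [_root_.add_apply, _root_.smul_apply, smul_eq_mul]
    exact hsol x hx Y Z
  rw [scalAt, lapAt, ← mtrAt_add, heq, mtrAt_smul, mtrAt_self hi]
  ring

/-- **`∇(Ric + Hess F) = 0` on a gradient shrinker** (the covariant derivative of `½ G` vanishes,
`∇G = 0`), componentwise: `(∇_W Ric)(Y,Z) + (∇_W Hess F)(Y,Z) = 0`.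
[cite: HaslhoferMuller2011, §2 (2.2)–(2.4) (p. 5)] -/
theorem cov₂At_ricAt_add_cov₂At_hessAt_of_soliton (hG : IsMetricOn G V) (hx : x ∈ V)
    (hF : ContDiffOn ℝ ∞ F V)
    (hsol : ∀ y ∈ V, ∀ Y Z : E, ricAt G y Y Z + hessAt G F y Y Z = (1 / 2 : ℝ) * G y Y Z)
    (W Y Z : E) :
    cov₂At G (ricAt G) x W Y Z + cov₂At G (hessAt G F) x W Y Z = 0 := by
  have hR := hG.differentiableAt_ricAt hx
  have hH := hG.differentiableAt_hessAt hx hF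
  -- the scalar components agree near `x`, hence so do their differentials
  have hev : (fun y ↦ ricAt G y Y Z + hessAt G F y Y Z) =ᶠ[𝓝 x] fun y ↦ (1 / 2 : ℝ) * G y Y Z := by
    filter_upwards [hG.mem_nhds hx] with y hy using hsol y hy Y Z
  have hRYZ : DifferentiableAt ℝ (fun y ↦ ricAt G y Y Z) x :=
    differentiableAt_clm_apply_const (differentiableAt_clm_apply_const hR Y) Z
  have hHYZ : DifferentiableAt ℝ (fun y ↦ hessAt G F y Y Z) x :=
    differentiableAt_clm_apply_const (differentiableAt_clm_apply_const hH Y) Z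
  have hGYZ : DifferentiableAt ℝ (fun y ↦ G y Y Z) x :=
    differentiableAt_clm_apply_const (differentiableAt_clm_apply_const (hG.differentiableAt hx) Y) Z
  have hD : fderiv ℝ (ricAt G) x W Y Z + fderiv ℝ (hessAt G F) x W Y Z =
      (1 / 2 : ℝ) * fderiv ℝ G x W Y Z := by
    have h1 : fderiv ℝ (fun y ↦ ricAt G y Y Z) x W = fderiv ℝ (ricAt G) x W Y Z := by
      rw [fderiv_clm_apply_const (differentiableAt_clm_apply_const hR Y) Z,
        fderiv_clm_apply_const hR Y]
    have h2 : fderiv ℝ (fun y ↦ hessAt G F y Y Z) x W = fderiv ℝ (hessAt G F) x W Y Z := by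
      rw [fderiv_clm_apply_const (differentiableAt_clm_apply_const hH Y) Z,
        fderiv_clm_apply_const hH Y]
    have h3 : fderiv ℝ (fun y ↦ G y Y Z) x W = fderiv ℝ G x W Y Z := by
      rw [fderiv_clm_apply_const (differentiableAt_clm_apply_const (hG.differentiableAt hx) Y) Z,
        fderiv_clm_apply_const (hG.differentiableAt hx) Y]
    have h4 := congrArg (fun T ↦ T W) (hev.fderiv_eq (𝕜 := ℝ))
    rw [fderiv_fun_add hRYZ hHYZ, fderiv_const_mul hGYZ (1 / 2 : ℝ)] at h4
    simp only [_root_.add_apply, _root_.smul_apply, smul_eq_mul, h1, h2, h3] at h4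
    simpa using h4
  have hx0 := hsol x hx (chrAt G x W Y) Z
  have hx1 := hsol x hx Y (chrAt G x W Z)
  simp only [cov₂At_apply]
  rw [hG.fderiv_eq_chrAt hx] at hD
  linarith

/-- **Haslhofer–Müller (2.4)**: `Ric(∇F, ·) = ½ dR` on a gradient shrinker ("using the contracted
second Bianchi identity"), in coordinates: contract `∇(Ric + Hess F) = 0` through the metric,
with `dS = 2 div Ric` (`IsMetricOn.fderiv_scalAt'`), `div Hess F = dΔF + Ric(♯dF, ·)`
(`IsMetricOn.sum_ginv_cov₂At_hessAt`) and `ΔF = n/2 − S`.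
[cite: HaslhoferMuller2011, §2 (2.4) (p. 5)] -/
theorem ricAt_sharpAt_eq_half_fderiv_scalAt (hG : IsMetricOn G V) (hx : x ∈ V)
    (hF : ContDiffOn ℝ ∞ F V)
    (hsol : ∀ y ∈ V, ∀ Y Z : E, ricAt G y Y Z + hessAt G F y Y Z = (1 / 2 : ℝ) * G y Y Z)
    (Z : E) :
    ricAt G x (sharpAt G x (fderiv ℝ F x)) Z = (1 / 2 : ℝ) * fderiv ℝ (scalAt G) x Z := by
  set b := Module.finBasis ℝ E
  have h1 := hG.fderiv_scalAt' b hx Z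
  have h2 := hG.sum_ginv_cov₂At_hessAt b hx hF Z
  have h3 : ∑ k, ∑ l, ginv G b x k l * cov₂At G (ricAt G) x (b k) (b l) Z +
      ∑ k, ∑ l, ginv G b x k l * cov₂At G (hessAt G F) x (b k) (b l) Z = 0 := by
    rw [← Finset.sum_add_distrib]
    refine Finset.sum_eq_zero fun k _ ↦ ?_
    rw [← Finset.sum_add_distrib]
    refine Finset.sum_eq_zero fun l _ ↦ ?_
    rw [← mul_add, cov₂At_ricAt_add_cov₂At_hessAt_of_soliton hG hx hF hsol, mul_zero]
  have h4 : fderiv ℝ (lapAt G F) x Z = -fderiv ℝ (scalAt G) x Z := by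
    have heq : lapAt G F =ᶠ[𝓝 x] fun y ↦ (finrank ℝ E : ℝ) / 2 - scalAt G y := by
      filter_upwards [hG.mem_nhds hx] with y hy
      have := scalAt_add_lapAt_of_soliton hG hy hsol
      linarith
    rw [heq.fderiv_eq, fderiv_const_sub, _root_.neg_apply]
  rw [h2, h4] at h3
  linarith

/-- **Haslhofer–Müller (2.5)** (Hamilton: `R + |∇f|² − f` is constant): `d(S + |∇F|²_G − F) = 0`
on a gradient shrinker, in coordinates (`∂_Z|∇F|² = 2 Hess F(Z, ♯dF)`, the soliton equation and
(2.4)). [cite: HaslhoferMuller2011, §2 (2.5) (p. 5)] -/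
theorem fderiv_scalAt_add_gradSqAt_sub_eq_zero (hG : IsMetricOn G V) (hx : x ∈ V)
    (hF : ContDiffOn ℝ ∞ F V)
    (hsol : ∀ y ∈ V, ∀ Y Z : E, ricAt G y Y Z + hessAt G F y Y Z = (1 / 2 : ℝ) * G y Y Z) :
    fderiv ℝ (fun y ↦ scalAt G y + gradSqAt G F y - F y) x = 0 := by
  have hi := hG.isInvertible x hx
  have hs := hG.symm x hx
  have hS : DifferentiableAt ℝ (scalAt G) x := (hG.contDiffAt_scalAt hx).differentiableAt (by simp)
  have hg := hG.differentiableAt_gradSqAt hx hF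
  have hf : DifferentiableAt ℝ F x :=
    (contDiffAt_of_contDiffOn hG.isOpen hF hx).differentiableAt (by simp)
  have hd : HasFDerivAt (fun y ↦ scalAt G y + gradSqAt G F y - F y)
      (fderiv ℝ (scalAt G) x + fderiv ℝ (gradSqAt G F) x - fderiv ℝ F x) x :=
    (hS.hasFDerivAt.add hg.hasFDerivAt).sub hf.hasFDerivAt
  rw [hd.fderiv]
  ext Z
  simp only [_root_.sub_apply, _root_.add_apply,
    _root_.zero_apply, hG.fderiv_gradSqAt hx hF Z]
  have hsolx := hsol x hx Z (sharpAt G x (fderiv ℝ F x))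
  have hGZ : G x Z (sharpAt G x (fderiv ℝ F x)) = fderiv ℝ F x Z := apply_apply_sharpAt hi hs _ Z
  have hRic : ricAt G x Z (sharpAt G x (fderiv ℝ F x)) = (1 / 2 : ℝ) * fderiv ℝ (scalAt G) x Z := by
    rw [hG.ricAt_comm hx]
    exact ricAt_sharpAt_eq_half_fderiv_scalAt hG hx hF hsol Z
  linarith

/-- **Haslhofer–Müller (2.7)**, the elliptic equation for the scalar curvature of a gradient
shrinker normalised by `R + |∇F|² = F`: `ΔS = ⟨∇F, ∇S⟩ + S − 2|Ric|²` in coordinates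
(`S = F − |∇F|²`, the Bochner formula `IsMetricOn.lapAt_gradSqAt`, `|Hess F|² = |Ric − ½G|² =
|Ric|² − S + n/4`, `ΔF = n/2 − S` and (2.4)). [cite: HaslhoferMuller2011, §2 (2.7) (p. 5)] -/
theorem lapAt_scalAt_of_soliton (hG : IsMetricOn G V) (hx : x ∈ V) (hF : ContDiffOn ℝ ∞ F V)
    (hsol : ∀ y ∈ V, ∀ Y Z : E, ricAt G y Y Z + hessAt G F y Y Z = (1 / 2 : ℝ) * G y Y Z)
    (hnorm : ∀ y ∈ V, scalAt G y + gradSqAt G F y = F y) :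
    lapAt G (scalAt G) x =
      fderiv ℝ (scalAt G) x (sharpAt G x (fderiv ℝ F x)) + scalAt G x
        - 2 * normSqAt G x (ricAt G x) := by
  have hi := hG.isInvertible x hx
  have hs := hG.symm x hx
  have hV := hG.isOpen
  -- smoothness
  have hSc : ContDiffOn ℝ ∞ (scalAt G) V := hG.contDiffOn_scalAt
  have hgc : ContDiffOn ℝ ∞ (gradSqAt G F) V := hG.contDiffOn_gradSqAt hF
  -- `S = F − |∇F|²` on `V`, so `ΔS = ΔF − Δ|∇F|²`
  have hSeq : ∀ y ∈ V, scalAt G y = F y - gradSqAt G F y := fun y hy ↦ by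
    have := hnorm y hy; linarith
  have hlap : lapAt G (scalAt G) x = lapAt G F x - lapAt G (gradSqAt G F) x := by
    have heq : scalAt G =ᶠ[𝓝 x] fun y ↦ F y - gradSqAt G F y := by
      filter_upwards [hG.mem_nhds hx] with y hy using hSeq y hy
    rw [show lapAt G (scalAt G) x = lapAt G (fun y ↦ F y - gradSqAt G F y) x from ?_]
    · exact lapAt_sub G (contDiffAt_two_of_contDiffOn hV hF hx)
        (contDiffAt_two_of_contDiffOn hV hgc hx)
    · -- `lapAt` only depends on the germ
      simp only [lapAt, hessAt, heq.fderiv_eq]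
      have h2 : fderiv ℝ (fderiv ℝ (scalAt G)) x = fderiv ℝ (fderiv ℝ fun y ↦ F y - gradSqAt G F y) x := by
        have : fderiv ℝ (scalAt G) =ᶠ[𝓝 x] fderiv ℝ (fun y ↦ F y - gradSqAt G F y) :=
          heq.fderiv
        exact this.fderiv_eq
      rw [h2]
  -- Bochner
  have hB := hG.lapAt_gradSqAt hx hF
  -- `Hess F = ½ G − Ric`, so `|Hess F|² = |Ric|² − S + n/4`
  have hHess : hessAt G F x = -(ricAt G x - (1 / 2 : ℝ) • G x) := by
    ext Y Z
    simp only [_root_.neg_apply, _root_.sub_apply,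
      _root_.smul_apply, smul_eq_mul]
    have := hsol x hx Y Z
    linarith
  have hN : normSqAt G x (hessAt G F x) =
      normSqAt G x (ricAt G x) - scalAt G x + (finrank ℝ E : ℝ) / 4 := by
    rw [hHess, ← neg_one_smul ℝ (ricAt G x - (1 / 2 : ℝ) • G x), normSqAt_smul, normSqAt_sub_smul_metric hi hs (hG.ricAt_comm hx), ← scalAt]
    ring
  -- `∂_{∇F} ΔF = −∂_{∇F} S`
  have h4 : fderiv ℝ (lapAt G F) x (sharpAt G x (fderiv ℝ F x)) =
      -fderiv ℝ (scalAt G) x (sharpAt G x (fderiv ℝ F x)) := by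
    have heq : lapAt G F =ᶠ[𝓝 x] fun y ↦ (finrank ℝ E : ℝ) / 2 - scalAt G y := by
      filter_upwards [hG.mem_nhds hx] with y hy
      have := scalAt_add_lapAt_of_soliton hG hy hsol
      linarith
    rw [heq.fderiv_eq, fderiv_const_sub, _root_.neg_apply]
  -- `Ric(∇F, ∇F) = ½ ∂_{∇F} S`
  have h5 := ricAt_sharpAt_eq_half_fderiv_scalAt hG hx hF hsol (sharpAt G x (fderiv ℝ F x))
  -- `ΔF = n/2 − S`
  have h6 := scalAt_add_lapAt_of_soliton hG hx hsol
  rw [hlap, hB, hN, h4, h5]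
  linarith

end CoordIdentities

/-! ### Parallel transport is smooth in the parameter (linear ODE bootstrap) -/

section ParallelSmooth

/-- **Solutions of a linear ODE with `C^∞` coefficient are `C^∞`**: if `v' = A(t) v` on an open
set of times where `A` is `C^∞`, then `v` is `C^∞` there (bootstrap: `v ∈ C^k ⇒ v' = Av ∈ C^k ⇒
v ∈ C^{k+1}`; Lang 1995, Ch. IV §1, the regularity part of Prop. 1.9). [folklore] -/
theorem contDiffOn_of_hasDerivAt_linear {W : Type*} [NormedAddCommGroup W] [NormedSpace ℝ W]
    {A : ℝ → W →L[ℝ] W} {s : Set ℝ} (hs : IsOpen s) (hA : ContDiffOn ℝ ∞ A s) {v : ℝ → W}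
    (hv : ∀ t ∈ s, HasDerivAt v (A t (v t)) t) : ContDiffOn ℝ ∞ v s := by
  have hderiv : ∀ t ∈ s, deriv v t = A t (v t) := fun t ht ↦ (hv t ht).deriv
  have hdiff : DifferentiableOn ℝ v s := fun t ht ↦
    (hv t ht).differentiableAt.differentiableWithinAt
  suffices h : ∀ k : ℕ, ContDiffOn ℝ k v s from contDiffOn_infty.2 h
  intro k
  induction k with
  | zero =>
    rw [Nat.cast_zero]
    exact contDiffOn_zero.2 hdiff.continuousOn
  | succ k ih =>
    rw [Nat.cast_succ, contDiffOn_succ_iff_deriv_of_isOpen hs]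
    refine ⟨hdiff, fun h ↦ (WithTop.natCast_ne_top k h).elim, ?_⟩
    have hle : ((k : ℕ) : ℕ∞ω) ≤ (∞ : ℕ∞ω) := by exact_mod_cast le_top
    exact ((hA.of_le hle).clm_apply ih).congr fun t ht ↦ hderiv t ht

universe u

variable {E : Type u} [NormedAddCommGroup E] [NormedSpace ℝ E] [FiniteDimensional ℝ E]
  [CompleteSpace E] {M : Type*} [TopologicalSpace M] [ChartedSpace E M] [IsManifold 𝓘(ℝ, E) ∞ M]

omit [CompleteSpace E] in
/-- **Parallel fields along a `C^∞` curve have `C^∞` lifts** (Lee 2018, Thm. 4.32: the parallel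
transport is the solution of a linear ODE with smooth coefficients, `w' = -Γ(γ, γ̇) w`, hence
smooth): if `W` is parallel along the `C^∞` curve `γ` on the open parameter set `s` (for a
locally `C^∞` covariant derivative), then `t ↦ (γ t, W t)` is `C^∞` at every `t₀ ∈ s` — read the
field in the trivialisation at `γ t₀` (`continuousLinearMapAt_covariantDerivAlong_symmL_Γmat`:
`w' = -Γmat(γ, γ̇) w` with `Γmat` smooth) and bootstrap (`contDiffOn_of_hasDerivAt_linear`).
[cite: LeeRiemannianManifolds2018, Thm. 4.32] -/
theorem contMDiffAt_lift_of_isParallelAlongOn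
    (cov : CovariantDerivative 𝓘(ℝ, E) E (TangentSpace 𝓘(ℝ, E) : M → Type _))
    (hcov : cov.IsLocallyContMDiff ∞) {γ : ℝ → M} (hγ : ContMDiff 𝓘(ℝ, ℝ) 𝓘(ℝ, E) ∞ γ)
    {W : Π t : ℝ, TangentSpace 𝓘(ℝ, E) (γ t)} {s : Set ℝ} (hs : IsOpen s)
    (hW : IsParallelAlongOn cov γ W s) {t₀ : ℝ} (ht₀ : t₀ ∈ s) :
    ContMDiffAt 𝓘(ℝ, ℝ) 𝓘(ℝ, E).tangent ∞
      (fun t ↦ (TotalSpace.mk' E (γ t) (W t) : TangentBundle 𝓘(ℝ, E) M)) t₀ := by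
  set x₁ := γ t₀ with hx₁
  set e := trivializationAt E (TangentSpace 𝓘(ℝ, E) : M → Type _) x₁ with he_def
  -- an open neighbourhood of `t₀` inside `s` on which `γ` stays in the chart domain of `x₁`
  have hsrc_nhds : ∀ᶠ t in 𝓝 t₀, γ t ∈ (chartAt E x₁).source :=
    (hγ t₀).continuousAt.preimage_mem_nhds
      ((chartAt E x₁).open_source.mem_nhds (mem_chart_source E x₁))
  obtain ⟨J, hJ_nhds, hJ_open, hJ⟩ : ∃ J : Set ℝ, J ∈ 𝓝 t₀ ∧ IsOpen J ∧
      ∀ t ∈ J, t ∈ s ∧ γ t ∈ (chartAt E x₁).source := by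
    obtain ⟨J, hJsub, hJopen, hJmem⟩ :=
      mem_nhds_iff.1 (Filter.inter_mem (hs.mem_nhds ht₀) hsrc_nhds)
    exact ⟨J, hJopen.mem_nhds hJmem, hJopen, fun t ht ↦ hJsub ht⟩
  have ht₀J : t₀ ∈ J := mem_of_mem_nhds hJ_nhds
  -- coordinates of `W` and of `γ'` in the trivialisation at `x₁`
  set w : ℝ → E := fun t ↦ (e ⟨γ t, W t⟩).2 with hw_def
  set U : ℝ → E := fun t ↦ (e ⟨γ t, velocity 𝓘(ℝ, E) γ t⟩).2 with hU_def
  have hbase : ∀ t ∈ J, γ t ∈ e.baseSet := fun t ht ↦ by simpa [he_def] using (hJ t ht).2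
  have hsrcW : ∀ t ∈ J, (TotalSpace.mk' E (γ t) (W t) : TangentBundle 𝓘(ℝ, E) M) ∈ e.source :=
    fun t ht ↦ by rw [e.mem_source]; exact hbase t ht
  have hWw : ∀ t ∈ J, e.symmL ℝ (γ t) (w t) = W t := fun t ht ↦ by
    simp only [hw_def]
    rw [← e.continuousLinearMapAt_apply_of_mem ℝ (hbase t ht)]
    exact e.symmL_continuousLinearMapAt (hbase t ht) (W t)
  -- `w` is differentiable on `J`
  have hwd : ∀ t ∈ J, DifferentiableAt ℝ w t := fun t ht ↦ by
    have h1 := (hW t (hJ t ht).1).1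
    have h2 := ((e.mdifferentiableAt_totalSpace_iff 𝓘(ℝ, E)
      (fun t ↦ (TotalSpace.mk' E (γ t) (W t) : TangentBundle 𝓘(ℝ, E) M)) (hsrcW t ht)).1 h1).2
    exact h2.differentiableAt
  -- `U` is smooth on `J`
  have hlift := contMDiff_lift_velocity_of_contMDiff (I := 𝓘(ℝ, E)) hγ
  have hUc : ∀ t ∈ J, ContDiffAt ℝ ∞ U t := fun t ht ↦ by
    have hsrcV : (TotalSpace.mk' E (γ t) (velocity 𝓘(ℝ, E) γ t) : TangentBundle 𝓘(ℝ, E) M) ∈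
        e.source := by rw [e.mem_source]; exact hbase t ht
    have h := ((e.contMDiffAt_iff (n := ∞) (IB := 𝓘(ℝ, E)) (IM := 𝓘(ℝ, ℝ))
      (f := fun t ↦ (TotalSpace.mk' E (γ t) (velocity 𝓘(ℝ, E) γ t) : TangentBundle 𝓘(ℝ, E) M))
      hsrcV).1 (hlift t)).2
    exact contMDiffAt_iff_contDiffAt.1 h
  -- the coefficient of the parallel transport equation, smooth on `J`
  set A : ℝ → E →L[ℝ] E := fun t ↦ -Γmat cov hcov x₁ (γ t) (U t) with hA_def
  have hsrcx : ∀ t ∈ J, γ t ∈ (extChartAt 𝓘(ℝ, E) x₁).source := fun t ht ↦ by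
    rw [extChartAt_source]; exact (hJ t ht).2
  have hA : ContDiffOn ℝ ∞ A J := by
    have hG := contDiffOn_Γmat cov hcov x₁
    have hq : ContDiffOn ℝ ∞ (fun t ↦ ((extChartAt 𝓘(ℝ, E) x₁) (γ t), U t)) J := by
      refine ContDiffOn.prodMk (fun t ht ↦ ?_) (fun t ht ↦ (hUc t ht).contDiffWithinAt)
      have h := (contMDiffAt_extChartAt' (I := 𝓘(ℝ, E)) (n := ∞) ((hJ t ht).2)).comp t (hγ t)
      exact (contMDiffAt_iff_contDiffAt.1 h).contDiffWithinAt
    have hmaps : MapsTo (fun t ↦ ((extChartAt 𝓘(ℝ, E) x₁) (γ t), U t)) J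
        ((extChartAt 𝓘(ℝ, E) x₁).target ×ˢ univ) := fun t ht ↦
      ⟨(extChartAt 𝓘(ℝ, E) x₁).map_source (hsrcx t ht), mem_univ _⟩
    have hcomp := (hG.comp hq hmaps).neg
    refine hcomp.congr fun t ht ↦ ?_
    simp only [hA_def, Function.comp_apply]
    rw [(extChartAt 𝓘(ℝ, E) x₁).left_inv (hsrcx t ht)]
  -- the parallel transport equation `w' = A w` on `J`
  have hode : ∀ t ∈ J, HasDerivAt w (A t (w t)) t := fun t ht ↦ by
    have hγd : MDifferentiableAt 𝓘(ℝ, ℝ) 𝓘(ℝ, E) γ t := (hγ t).mdifferentiableAt (by simp)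
    have hchart := continuousLinearMapAt_covariantDerivAlong_symmL_Γmat cov hcov x₁ (hJ t ht).2
      hγd (hwd t ht)
    have hev : ∀ᶠ t' in 𝓝 t, e.symmL ℝ (γ t') (w t') = W t' := by
      filter_upwards [hJ_open.mem_nhds ht] with t' ht' using hWw t' ht'
    rw [covariantDerivAlong_congr_field cov hev, (hW t (hJ t ht).1).2, map_zero] at hchart
    have hd : deriv w t = A t (w t) := by
      simp only [hA_def, _root_.neg_apply]
      exact eq_neg_of_add_eq_zero_left hchart.symm
    rw [← hd]
    exact (hwd t ht).hasDerivAt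
  -- bootstrap and conclude
  have hwC : ContDiffOn ℝ ∞ w J := contDiffOn_of_hasDerivAt_linear hJ_open hA hode
  rw [e.contMDiffAt_iff (n := ∞) (IB := 𝓘(ℝ, E)) (IM := 𝓘(ℝ, ℝ))
    (f := fun t ↦ (TotalSpace.mk' E (γ t) (W t) : TangentBundle 𝓘(ℝ, E) M)) (hsrcW t₀ ht₀J)]
  exact ⟨hγ t₀, contMDiffAt_iff_contDiffAt.2 ((hwC t₀ ht₀J).contDiffAt hJ_nhds)⟩

end ParallelSmooth

/-! ### The distance barrier along a geodesic variation (towards the `f`-Laplacian comparison) -/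

section Barrier

/-- `d² ≤ T² + Z` with `d ≥ 0 < T` gives `d ≤ T + Z/(2T)` (concavity of the square root).
[folklore] -/
theorem le_add_div_of_sq_le {d T Z : ℝ} (hd : 0 ≤ d) (hT : 0 < T) (h : d ^ 2 ≤ T ^ 2 + Z) :
    d ≤ T + Z / (2 * T) := by
  have hZ : -T ^ 2 ≤ Z := by nlinarith [sq_nonneg d]
  have heq : T + Z / (2 * T) = (2 * T ^ 2 + Z) / (2 * T) := by
    field_simp
  have h2 : 0 ≤ T + Z / (2 * T) := by
    rw [heq]
    exact div_nonneg (by nlinarith) (by linarith)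
  have h1 : T ^ 2 + Z ≤ (T + Z / (2 * T)) ^ 2 := by
    have hw : 2 * T * (Z / (2 * T)) = Z := by field_simp
    have : (T + Z / (2 * T)) ^ 2 = T ^ 2 + Z + (Z / (2 * T)) ^ 2 := by
      calc (T + Z / (2 * T)) ^ 2 = T ^ 2 + 2 * T * (Z / (2 * T)) + (Z / (2 * T)) ^ 2 := by ring
        _ = T ^ 2 + Z + (Z / (2 * T)) ^ 2 := by rw [hw]
    rw [this]
    nlinarith [sq_nonneg (Z / (2 * T))]
  exact (pow_le_pow_iff_left₀ hd h2 two_ne_zero).1 (h.trans h1)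

variable {E : Type*} [NormedAddCommGroup E] [NormedSpace ℝ E] {H : Type*} [TopologicalSpace H]
  {I : ModelWithCorners ℝ E H} {M : Type*} [TopologicalSpace M] [ChartedSpace H M]
  [IsManifold I ∞ M] {n : ℕ∞ω} [FiniteDimensional ℝ E] [CompleteSpace E]
  (g : PseudoRiemannianMetric I n E (TangentSpace I : M → Type _)) [g.HasLeviCivita]
  [T2Space M] [BoundarylessManifold I M]
  [CovariantDerivative.ContMDiffCovariantDerivative g.leviCivita 1]
  [CovariantDerivative.ContMDiffCovariantDerivative g.leviCivita ∞]

set_option synthInstance.maxHeartbeats 100000 in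
/-- **Two-sided second-order Taylor bound for the energy** of `x(t, σ) = exp_{γ(t)}(σ X(t))`:
`integral_energy_le_taylor` for `X` and for `-X` (the variation of `-X` at `-σ` is that of `X` at
`σ`): for every `ε > 0` and `|σ|` small,
`∫_a^b |∂_t x|²(σ) ≤ ∫_a^b |γ'|² + σ ∫_a^b 2g(D_tX, γ') + σ²(∫_a^b q + ε(b − a))`.
[cite: LeeRiemannianManifolds2018, Thm. 10.22 and Thm. 10.26 (proof)] -/
theorem energy_le_taylor_two_sided (hn : (∞ : ℕ∞ω) ≤ n) (hc : IsGeodesicallyComplete g.leviCivita)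
    {γ : ℝ → M} {X : Π t : ℝ, TangentSpace I (γ t)}
    (hX : ContMDiff 𝓘(ℝ, ℝ) I.tangent ∞ (fun t ↦ (TotalSpace.mk' E (γ t) (X t) : TangentBundle I M)))
    {a b : ℝ} (hab : a ≤ b) :
    ∀ ε > 0, ∃ δ > 0, ∀ σ ∈ Icc (-δ) δ,
      ∫ t in a..b, g.val (expMap g.leviCivita (γ t) (σ • X t))
          (velocity I (fun t' ↦ expMap g.leviCivita (γ t') (σ • X t')) t)
          (velocity I (fun t' ↦ expMap g.leviCivita (γ t') (σ • X t')) t) ≤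
        (∫ t in a..b, g.val (γ t) (velocity I γ t) (velocity I γ t)) +
          σ * (∫ t in a..b, 2 * g.val (γ t) (covariantDerivAlong g.leviCivita γ X t) (velocity I γ t)) +
          σ * σ * ((∫ t in a..b,
            (g.val (γ t) (g.leviCivita.curvature (γ t) (X t) (velocity I γ t) (X t)) (velocity I γ t) +
              g.val (γ t) (covariantDerivAlong g.leviCivita γ X t)
                (covariantDerivAlong g.leviCivita γ X t))) + ε * (b - a)) := by
  obtain ⟨-, hplus⟩ := integral_energy_le_taylor g hn hc hX hab
  have hXn : ContMDiff 𝓘(ℝ, ℝ) I.tangent ∞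
      (fun t ↦ (TotalSpace.mk' E (γ t) (-X t) : TangentBundle I M)) :=
    fun t ↦ contMDiffAt_liftAlong_neg (hX t)
  obtain ⟨-, hminus⟩ := integral_energy_le_taylor g hn hc hXn hab
  have hD : ∀ t, covariantDerivAlong g.leviCivita γ (fun t ↦ -X t) t =
      -covariantDerivAlong g.leviCivita γ X t := by
    intro t
    have hL := covariantDerivAlong_smul_holds g.leviCivita (γ := γ) (W := X) (f := fun _ ↦ (-1 : ℝ))
      (t₀ := t) (differentiableAt_const _) ((hX t).mdifferentiableAt (by simp))
    simp only [neg_smul, one_smul, deriv_const, zero_smul, zero_add] at hL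
    exact hL
  intro ε hε
  obtain ⟨δ₁, hδ₁, h₁⟩ := hplus ε hε
  obtain ⟨δ₂, hδ₂, h₂⟩ := hminus ε hε
  refine ⟨min δ₁ δ₂, lt_min hδ₁ hδ₂, fun σ hσ ↦ ?_⟩
  rcases le_or_gt 0 σ with hσ0 | hσ0
  · exact h₁ σ ⟨hσ0, hσ.2.trans (min_le_left _ _)⟩
  · have h := h₂ (-σ) ⟨by linarith, by linarith [hσ.1, min_le_right δ₁ δ₂]⟩
    have e4 : ∀ t, (-σ) • -X t = σ • X t := fun t ↦ by rw [smul_neg, neg_smul, neg_neg]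
    have e1 : ∫ t in a..b, 2 * g.val (γ t) (covariantDerivAlong g.leviCivita γ (fun t ↦ -X t) t)
        (velocity I γ t) =
        -(∫ t in a..b, 2 * g.val (γ t) (covariantDerivAlong g.leviCivita γ X t) (velocity I γ t)) := by
      rw [← intervalIntegral.integral_neg]
      congr 1
      funext t
      rw [hD t, map_neg, _root_.neg_apply]
      ring
    have e2 : ∫ t in a..b,
        (g.val (γ t) (g.leviCivita.curvature (γ t) (-X t) (velocity I γ t) (-X t)) (velocity I γ t) +
          g.val (γ t) (covariantDerivAlong g.leviCivita γ (fun t ↦ -X t) t)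
            (covariantDerivAlong g.leviCivita γ (fun t ↦ -X t) t)) =
        ∫ t in a..b,
          (g.val (γ t) (g.leviCivita.curvature (γ t) (X t) (velocity I γ t) (X t)) (velocity I γ t) +
            g.val (γ t) (covariantDerivAlong g.leviCivita γ X t)
              (covariantDerivAlong g.leviCivita γ X t)) := by
      congr 1
      funext t
      simp only [hD t, map_neg, _root_.neg_apply, neg_neg]
    rw [e1, e2] at h
    have key : (∫ t in a..b, g.val (expMap g.leviCivita (γ t) (-σ • -X t))
          (velocity I (fun t' ↦ expMap g.leviCivita (γ t') (-σ • -X t')) t)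
          (velocity I (fun t' ↦ expMap g.leviCivita (γ t') (-σ • -X t')) t)) =
        ∫ t in a..b, g.val (expMap g.leviCivita (γ t) (σ • X t))
          (velocity I (fun t' ↦ expMap g.leviCivita (γ t') (σ • X t')) t)
          (velocity I (fun t' ↦ expMap g.leviCivita (γ t') (σ • X t')) t) :=
      congrArg (fun (Y : Π t, TangentSpace I (γ t)) ↦ ∫ t in a..b,
        g.val (expMap g.leviCivita (γ t) (Y t))
          (velocity I (fun t' ↦ expMap g.leviCivita (γ t') (Y t')) t)
          (velocity I (fun t' ↦ expMap g.leviCivita (γ t') (Y t')) t)) (funext e4)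
    have e5 : -σ * -(∫ t in a..b, 2 * g.val (γ t) (covariantDerivAlong g.leviCivita γ X t)
        (velocity I γ t)) =
        σ * ∫ t in a..b, 2 * g.val (γ t) (covariantDerivAlong g.leviCivita γ X t) (velocity I γ t) := by
      ring
    have e6 : -σ * -σ = σ * σ := by ring
    rw [e5, e6, key] at h
    exact h

/-- **Distance versus energy of the variation through `p`**: for `x(t, σ) = exp_{γ_u(t)}(σ X(t))`
with `X(0) = 0` (so that `x(0, σ) = p`), `d(p, x(T, σ))² ≤ T ∫_0^T |∂_t x|²`
(`edist_le_length`, arc length as an integral, Cauchy–Schwarz), and the distance is finite.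
[cite: LeeRiemannianManifolds2018, Problem 6-23 and p. 151] -/
theorem edist_sq_le_mul_energy (hn : (∞ : ℕ∞ω) ≤ n) (hg : g.IsRiemannian)
    (hc : IsGeodesicallyComplete g.leviCivita) (p : M) (u : TangentSpace I p)
    {X : Π t : ℝ, TangentSpace I (expMap g.leviCivita p (t • u))}
    (hX : ContMDiff 𝓘(ℝ, ℝ) I.tangent ∞
      (fun t ↦ (TotalSpace.mk' E (expMap g.leviCivita p (t • u)) (X t) : TangentBundle I M)))
    (h0 : X 0 = 0) {T : ℝ} (hT : 0 ≤ T) (σ : ℝ) :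
    g.edist hg p (expMap g.leviCivita (expMap g.leviCivita p (T • u)) (σ • X T)) ≠ ⊤ ∧
    (g.edist hg p (expMap g.leviCivita (expMap g.leviCivita p (T • u)) (σ • X T))).toReal ^ 2 ≤
      T * ∫ t in (0 : ℝ)..T, g.val (expMap g.leviCivita (expMap g.leviCivita p (t • u)) (σ • X t))
        (velocity I (fun t' ↦ expMap g.leviCivita (expMap g.leviCivita p (t' • u)) (σ • X t')) t)
        (velocity I (fun t' ↦ expMap g.leviCivita (expMap g.leviCivita p (t' • u)) (σ • X t')) t) := by
  haveI : Fact (1 ≤ n) := ⟨le_trans (by exact_mod_cast le_top) hn⟩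
  have hnn : ∀ (y : M) (v' : TangentSpace I y), 0 ≤ g.val y v' v' := fun y v' ↦ by
    by_cases hv : v' = 0
    · subst hv
      simp
    · exact (hg y v' hv).le
  set x : ℝ → ℝ → M := fun t σ ↦
    expMap g.leviCivita (expMap g.leviCivita p (t • u)) (σ • X t) with hx_def
  have hx : ContMDiff (𝓘(ℝ, ℝ).prod 𝓘(ℝ, ℝ)) I ∞ (uncurry x) :=
    contMDiff_uncurry_expMap_smul_field hc hX
  have hline : ContMDiff 𝓘(ℝ, ℝ) (𝓘(ℝ, ℝ).prod 𝓘(ℝ, ℝ)) ∞ (fun t : ℝ ↦ ((t, σ) : ℝ × ℝ)) :=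
    contMDiff_id.prodMk contMDiff_const
  have hγσ : ContMDiff 𝓘(ℝ, ℝ) I ∞ (fun t ↦ x t σ) := hx.comp hline
  have hTl := contMDiff_lift_velocity_of_contMDiff (I := I) hγσ
  have hsm : ContMDiff 𝓘(ℝ, ℝ) 𝓘(ℝ, ℝ) ∞ (fun t ↦ g.val (x t σ) (velocity I (fun t' ↦ x t' σ) t)
      (velocity I (fun t' ↦ x t' σ) t)) :=
    fun t ↦ contMDiffAt_val_apply_along g hn (hTl t) (hTl t)
  have hfc : Continuous fun t ↦ g.val (x t σ) (velocity I (fun t' ↦ x t' σ) t)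
      (velocity I (fun t' ↦ x t' σ) t) := hsm.continuous
  have h1le : (1 : ℕ∞ω) ≤ (∞ : ℕ∞ω) := by exact_mod_cast le_top
  have hc₁ : ContMDiffOn 𝓘(ℝ, ℝ) I 1 (fun t ↦ x t σ) (Icc 0 T) := (hγσ.of_le h1le).contMDiffOn
  have hγ0 : expMap g.leviCivita p ((0 : ℝ) • u) = p := by
    rw [zero_smul]
    exact expMap_zero (cov := g.leviCivita) p
  have e0 : x 0 σ = p := by
    show expMap g.leviCivita (expMap g.leviCivita p ((0 : ℝ) • u)) (σ • X 0) = p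
    rw [h0, smul_zero, expMap_zero (cov := g.leviCivita)]
    exact hγ0
  have hd : g.edist hg p (x T σ) ≤ g.length hg (fun t ↦ x t σ) 0 T := by
    have h := g.edist_le_length hg hT hc₁
    rwa [e0] at h
  have hL := length_eq_ofReal_integral g hg hT hfc
  have hℓ : 0 ≤ ∫ t in (0 : ℝ)..T, Real.sqrt (g.val (x t σ) (velocity I (fun t' ↦ x t' σ) t)
      (velocity I (fun t' ↦ x t' σ) t)) :=
    intervalIntegral.integral_nonneg hT fun t _ ↦ Real.sqrt_nonneg _
  rw [hL] at hd
  refine ⟨ne_top_of_le_ne_top ENNReal.ofReal_ne_top hd, ?_⟩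
  have hdr : (g.edist hg p (x T σ)).toReal ≤ ∫ t in (0 : ℝ)..T, Real.sqrt (g.val (x t σ)
      (velocity I (fun t' ↦ x t' σ) t) (velocity I (fun t' ↦ x t' σ) t)) :=
    ENNReal.toReal_le_of_le_ofReal hℓ hd
  have hsc : Continuous fun t ↦ Real.sqrt (g.val (x t σ) (velocity I (fun t' ↦ x t' σ) t)
      (velocity I (fun t' ↦ x t' σ) t)) := Real.continuous_sqrt.comp hfc
  have hCS := sq_intervalIntegral_le_length_mul_of_continuous hsc hT
  have hsq : (fun t ↦ Real.sqrt (g.val (x t σ) (velocity I (fun t' ↦ x t' σ) t)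
      (velocity I (fun t' ↦ x t' σ) t)) ^ 2) =
      fun t ↦ g.val (x t σ) (velocity I (fun t' ↦ x t' σ) t) (velocity I (fun t' ↦ x t' σ) t) :=
    funext fun t ↦ Real.sq_sqrt (hnn _ _)
  rw [hsq, sub_zero] at hCS
  exact (pow_le_pow_left₀ ENNReal.toReal_nonneg hdr 2).trans hCS

/-- **The distance barrier along a geodesic variation** (the second variation of arc length in
upper-barrier form, the input of Calabi's argument for the Laplacian comparison of the distance
function; cf. the proof of (2.6) in [Zha09] and Wei–Wylie's `f`-Laplacian comparison): for a unit
speed geodesic `γ_u` from `p`, a `C^∞` field `X` along it with `X(0) = 0`, `T > 0` and every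
`ε > 0`, for `|σ|` small, `d(p, exp_{γ_u(T)}(σ X(T))) ≤ T + σ g(X(T), γ̇_u(T)) + σ²(∫_0^T q + εT)/2`
with `q = g(R(X,γ̇)X,γ̇) + |D_t X|²` the index integrand (`edist_sq_le_mul_energy`,
`energy_le_taylor_two_sided`, `∫_0^T 2g(D_tX, γ̇) = 2g(X(T), γ̇(T))` by
`integral_val_covariantDerivAlong_velocity`, and `√(T² + Z) ≤ T + Z/2T`).
[cite: LeeRiemannianManifolds2018, Thm. 10.22 (second variation)] -/
theorem edist_toReal_le_taylor (hn : (∞ : ℕ∞ω) ≤ n) (hg : g.IsRiemannian)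
    (hc : IsGeodesicallyComplete g.leviCivita) (p : M) (u : TangentSpace I p)
    (hu : g.val p u u = 1)
    {X : Π t : ℝ, TangentSpace I (expMap g.leviCivita p (t • u))}
    (hX : ContMDiff 𝓘(ℝ, ℝ) I.tangent ∞
      (fun t ↦ (TotalSpace.mk' E (expMap g.leviCivita p (t • u)) (X t) : TangentBundle I M)))
    (h0 : X 0 = 0) {T : ℝ} (hT : 0 < T) :
    ∀ ε > 0, ∃ δ > 0, ∀ σ ∈ Icc (-δ) δ,
      (g.edist hg p (expMap g.leviCivita (expMap g.leviCivita p (T • u)) (σ • X T))).toReal ≤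
        T + σ * g.val (expMap g.leviCivita p (T • u)) (X T)
            (velocity I (fun t ↦ expMap g.leviCivita p (t • u)) T) +
          σ ^ 2 * ((∫ t in (0 : ℝ)..T,
            (g.val (expMap g.leviCivita p (t • u))
              (g.leviCivita.curvature (expMap g.leviCivita p (t • u)) (X t)
                (velocity I (fun t ↦ expMap g.leviCivita p (t • u)) t) (X t))
              (velocity I (fun t ↦ expMap g.leviCivita p (t • u)) t) +
            g.val (expMap g.leviCivita p (t • u))
              (covariantDerivAlong g.leviCivita (fun t ↦ expMap g.leviCivita p (t • u)) X t)
              (covariantDerivAlong g.leviCivita (fun t ↦ expMap g.leviCivita p (t • u)) X t))) +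
            ε * T) / 2 := by
  haveI : Fact (1 ≤ n) := ⟨le_trans (by exact_mod_cast le_top) hn⟩
  intro ε hε
  obtain ⟨δ, hδ, hδ'⟩ := energy_le_taylor_two_sided g hn hc hX hT.le ε hε
  refine ⟨δ, hδ, fun σ hσ ↦ ?_⟩
  have hA := hδ' σ hσ
  obtain ⟨-, hd2⟩ := edist_sq_le_mul_energy g hn hg hc p u hX h0 hT.le σ
  -- the geodesic `γ_u`: energy `T`, first variation `2 g(X T, γ̇ T)`
  have hgeo : IsGeodesic g.leviCivita (fun t ↦ expMap g.leviCivita p (t • u)) :=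
    isGeodesic_expMap_smul_of_isGeodesicallyComplete hc p u
  have hγ : ContMDiff 𝓘(ℝ, ℝ) I ∞ (fun t ↦ expMap g.leviCivita p (t • u)) :=
    fun t ↦ (contMDiffAt_totalSpace.1 (hX t)).1
  have hF := integral_val_covariantDerivAlong_velocity g hn hgeo hγ hX 0 T
  have hF' : ∫ t in (0 : ℝ)..T, 2 * g.val (expMap g.leviCivita p (t • u))
      (covariantDerivAlong g.leviCivita (fun t ↦ expMap g.leviCivita p (t • u)) X t)
      (velocity I (fun t ↦ expMap g.leviCivita p (t • u)) t) =
      2 * g.val (expMap g.leviCivita p (T • u)) (X T)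
          (velocity I (fun t ↦ expMap g.leviCivita p (t • u)) T) := by
    rw [intervalIntegral.integral_const_mul, hF, h0]
    simp
  have hγ0 : expMap g.leviCivita p ((0 : ℝ) • u) = p := by
    rw [zero_smul]
    exact expMap_zero (cov := g.leviCivita) p
  have hspeed : ∀ t, g.val (expMap g.leviCivita p (t • u))
      (velocity I (fun t ↦ expMap g.leviCivita p (t • u)) t)
      (velocity I (fun t ↦ expMap g.leviCivita p (t • u)) t) = 1 := by
    intro t
    have h := g.val_velocity_eq_of_isGeodesicOn_holds isOpen_univ ordConnected_univ hgeo
      (mem_univ t) (mem_univ 0)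
    have hv0 : (velocity I (fun t ↦ expMap g.leviCivita p (t • u)) 0 : E) = (u : E) :=
      velocity_expMap_smul_zero p u
    have h' : g.val (expMap g.leviCivita p (t • u))
        (velocity I (fun t ↦ expMap g.leviCivita p (t • u)) t)
        (velocity I (fun t ↦ expMap g.leviCivita p (t • u)) t) =
        g.val (expMap g.leviCivita p ((0 : ℝ) • u))
          (velocity I (fun t ↦ expMap g.leviCivita p (t • u)) 0)
          (velocity I (fun t ↦ expMap g.leviCivita p (t • u)) 0) := h
    rw [h', hv0, hγ0, hu]
  have hE₀ : ∫ t in (0 : ℝ)..T, g.val (expMap g.leviCivita p (t • u))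
      (velocity I (fun t ↦ expMap g.leviCivita p (t • u)) t)
      (velocity I (fun t ↦ expMap g.leviCivita p (t • u)) t) = T := by
    simp_rw [hspeed]
    rw [intervalIntegral.integral_const, smul_eq_mul]
    ring
  rw [hE₀, hF', sub_zero] at hA
  -- combine
  set a : ℝ := g.val (expMap g.leviCivita p (T • u)) (X T)
    (velocity I (fun t ↦ expMap g.leviCivita p (t • u)) T) with ha
  set Q : ℝ := ∫ t in (0 : ℝ)..T,
      (g.val (expMap g.leviCivita p (t • u))
        (g.leviCivita.curvature (expMap g.leviCivita p (t • u)) (X t)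
          (velocity I (fun t ↦ expMap g.leviCivita p (t • u)) t) (X t))
        (velocity I (fun t ↦ expMap g.leviCivita p (t • u)) t) +
      g.val (expMap g.leviCivita p (t • u))
        (covariantDerivAlong g.leviCivita (fun t ↦ expMap g.leviCivita p (t • u)) X t)
        (covariantDerivAlong g.leviCivita (fun t ↦ expMap g.leviCivita p (t • u)) X t)) with hQ
  set d : ℝ := (g.edist hg p (expMap g.leviCivita (expMap g.leviCivita p (T • u)) (σ • X T))).toReal
    with hd
  have hZ : d ^ 2 ≤ T ^ 2 + T * (σ * (2 * a) + σ * σ * (Q + ε * T)) := by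
    have h := hd2.trans (mul_le_mul_of_nonneg_left hA hT.le)
    nlinarith [h]
  have hfin := le_add_div_of_sq_le ENNReal.toReal_nonneg hT hZ
  have heq : T + T * (σ * (2 * a) + σ * σ * (Q + ε * T)) / (2 * T) =
      T + σ * a + σ ^ 2 * (Q + ε * T) / 2 := by
    field_simp
    ring
  linarith [hfin, heq.le, heq.ge]

end Barrier

end HaslhoferMuller

end Literature.Geometry.Riemannian

end
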